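import Literature.Analysis.FluidPDE.ElgindiAngularWeightedBounds
import Literature.Analysis.FluidPDE.ElgindiWeightedIBP
import HarnessLib

/-!
# One-dimensional integrations by parts for Step 2 of Elgindi's weighted elliptic estimate
([Elgindi2021] §7.3, Proposition 7.7, Step 2)

Topic `Literature/Analysis/FluidPDE`. Proof file (everything proved, no definitions, no named
facts) on the proof path of the named fact
`Literature.Analysis.FluidPDE.Elgindi.ElgindiGhoulMasmoudi2021_stabilityCore`
(`ElgindiStabilityDecomposition.lean`). T. M. Elgindi, Ann. of Math. 194 (2021) =
arXiv:1904.04795, §7.3, proof of Proposition 7.7, Step 2 (p. 21–22 of the held text): the polar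
model equation is multiplied by `−∂_θθΨ·w²/sin(2θ)^η` and

> "After integrating by parts in the right way, `I₁` and `I₄` contain positive terms and some
> terms which we control by the information we gained from Step 1. […]
> `I₁ = α²(R²∂_{RR}Ψ, ∂_θθΨ w²/sin(2θ)^η) = −α²(R²∂_RΨ, ∂_{Rθθ}Ψ w²/sin(2θ)^η) + E`
> `= α²(R²∂_{Rθ}Ψ, ∂_{Rθ}Ψ w²/sin(2θ)^η) + α²(R²∂_RΨ, ∂_{Rθ}Ψ ∂_θ(w²/sin(2θ)^η)) + E`, […]
> `α²(R²∂_RΨ, ∂_{Rθ}Ψ ∂_θ(w²/sin(2θ)^η)) = −(α²/2)(R²∂_RΨ, ∂_RΨ ∂_θθ(w²/sin^η(2θ)))`. Observe that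
> `∂_θθ sin(2θ)^{−η} = 4η(η+1)cos²(2θ)/sin^{2+η}(2θ) + 4η/sin^η(2θ)`. […]
> `I_{4,1} = ((1−η)/2)(cos(2θ)(∂_θΨ̄)², w²/sin^η(2θ))`."

These are one-dimensional integrations by parts: one in `R` on `(0,∞)` against the radial weight
(polarized form of `ElgindiWeightedIBP.lean`), and several in `θ` on `(0, π/2)` against the
singular weight `u = sin(2θ)^{−η}`, `0 ≤ η < 1`, whose boundary terms vanish because the functions
involved are `O(sin 2θ)` at the endpoints (the singular toolkit of
`ElgindiAngularWeightedBounds.lean`). With `s = sin 2θ`, `c = cos 2θ`, `u' = −2ηcu/s`: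

* `integral_Ioi_weight_mul_deriv2_mul_polar`: `∫₀^∞ M f″g = −∫₀^∞ M′f′g − ∫₀^∞ M f′g′`;
* `integral_Ioo_rpow_mul_mul_deriv2` (**L1**): `∫ u f f″ = −∫ u f′² + 2η∫ c u s⁻¹ f f′` and
  `integral_Ioo_cos_rpow_inv_mul_mul_deriv` (**L2**, the `∂_θθ sin^{−η}` display):
  `∫ c u s⁻¹ f f′ = ∫ u f² + (1+η)∫ c²u (f/s)²`, for `f ∈ C²` resp. `C¹` with `f(0) = f(π/2) = 0`;
* `integral_Ioo_sin_rpow_mul_mul_deriv` (**L3**, the `I_{4,1}` display): `∫ s u g g′ = −(1−η)∫ c u g²`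
  for any `g ∈ C¹`;
* `integral_Ioo_cos_sq_rpow_mul_mul_deriv2` (**L4**): `∫ cos²θ u h h″ = −∫ cos²θ u h′² + ∫ s u h h′ +
  2η∫ c cos²θ u s⁻¹ h h′` and `integral_Ioo_cos_cos_sq_rpow_inv_mul_mul_deriv` (**L6**):
  `∫ c cos²θ u s⁻¹ h h′ = ∫ cos²θ u h² + ½∫ c u h² + (1+η)∫ c²u (cosθ h/s)²`, for `h ∈ C²` resp. `C¹`
  with `h(0) = 0` (the `sec(θ)Ψ`-terms of `I₄`).
-/

noncomputable section

open MeasureTheory Set Real Filter intervalIntegral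
open _root_.Topology

namespace Literature.Analysis.FluidPDE

namespace Elgindi

/-! ### The polarized weighted integration by parts on `(0, ∞)` -/

/-- **`∫₀^∞ M f″ g = −∫₀^∞ M′ f′ g − ∫₀^∞ M f′ g′`** for `M ∈ C¹((0,∞))`, `f ∈ C²(ℝ)`, and
`g ∈ C¹(ℝ)` compactly supported inside `(0,∞)`. [cite: Elgindi2021, §7.3 proof of Proposition 7.7 Step 2, first display for `I₁` (p. 21 of arXiv:1904.04795)] -/
theorem integral_Ioi_weight_mul_deriv2_mul_polar {M f g : ℝ → ℝ} (hM : ContDiffOn ℝ 1 M (Ioi 0))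
    (hf : ContDiff ℝ 2 f) (hg : ContDiff ℝ 1 g) (hs : HasCompactSupport g) (hsub : tsupport g ⊆ Ioi 0) :
    ∫ x in Ioi (0 : ℝ), M x * deriv (deriv f) x * g x =
      -(∫ x in Ioi (0 : ℝ), deriv M x * deriv f x * g x) - ∫ x in Ioi (0 : ℝ), M x * deriv f x * deriv g x := by
  obtain ⟨a, ha, hga⟩ := exists_pos_forall_lt_eq_zero' hs hsub
  have hf1 : ContDiff ℝ 1 (deriv f) := by have := hf.iterate_deriv' 1 1; simpa using this
  have hdf : Differentiable ℝ (deriv f) := hf1.differentiable (by simp)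
  have hdg : Differentiable ℝ g := hg.differentiable (by simp)
  have hgc := hg.continuous
  have hdgc : Continuous (deriv g) := hg.continuous_deriv le_rfl
  have hdfc : Continuous (deriv f) := hf1.continuous
  have hd2fc : Continuous (deriv (deriv f)) := hf1.continuous_deriv le_rfl
  have hdga : ∀ x, x < a → deriv g x = 0 := fun x hx => by
    have : g =ᶠ[𝓝 x] fun _ => 0 := Filter.eventuallyEq_of_mem (Iio_mem_nhds hx) fun y hy => hga y hy
    rw [this.deriv_eq, deriv_const]
  have hMd : ∀ x, 0 < x → HasDerivAt M (deriv M x) x := fun x hx =>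
    (hM.differentiableOn (by simp) |>.differentiableAt (Ioi_mem_nhds hx)).hasDerivAt
  have hM0 : ContDiffOn ℝ 0 (deriv M) (Ioi 0) := (hM.deriv_of_isOpen isOpen_Ioi (by simp))
  -- `F = M (f' g)` is `C¹` with compact support
  have hP : ContDiff ℝ 1 fun x => deriv f x * g x := hf1.mul hg
  have hPa : ∀ x, x < a → deriv f x * g x = 0 := fun x hx => by simp [hga x hx]
  have hF : ContDiff ℝ 1 fun x => M x * (deriv f x * g x) := contDiff_weight_mul hM hP ha hPa
  have hFs : HasCompactSupport fun x => M x * (deriv f x * g x) := by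
    have : (fun x => M x * (deriv f x * g x)) = fun x => (M x * deriv f x) * g x := by funext x; ring
    rw [this]; exact hs.mul_left
  have hF' : ∀ x, deriv (fun x => M x * (deriv f x * g x)) x =
      deriv M x * deriv f x * g x + (M x * deriv (deriv f) x * g x + M x * deriv f x * deriv g x) := by
    intro x
    rcases lt_or_ge x a with hx | hx
    · have : (fun x => M x * (deriv f x * g x)) =ᶠ[𝓝 x] fun _ => 0 :=
        Filter.eventuallyEq_of_mem (Iio_mem_nhds hx) fun y hy => by simp [hga y hy]
      rw [this.deriv_eq, deriv_const, hga x hx, hdga x hx]; ring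
    · have hx0 : 0 < x := lt_of_lt_of_le ha hx
      have hmul : HasDerivAt (fun x => M x * (deriv f x * g x))
          (deriv M x * (deriv f x * g x) + M x * (deriv (deriv f) x * g x + deriv f x * deriv g x)) x :=
        (hMd x hx0).mul ((hdf x).hasDerivAt.mul (hdg x).hasDerivAt)
      rw [hmul.deriv]; ring
  have h0 := integral_deriv_eq_zero_of_hasCompactSupport hF hFs
  simp_rw [hF'] at h0
  -- all integrands vanish off `(0,∞)`
  have hz1 : ∀ x, x ∉ Ioi (0 : ℝ) → deriv M x * deriv f x * g x = 0 := fun x hx => by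
    rw [hga x (lt_of_le_of_lt (not_lt.1 hx) ha)]; ring
  have hz2 : ∀ x, x ∉ Ioi (0 : ℝ) → M x * deriv (deriv f) x * g x = 0 := fun x hx => by
    rw [hga x (lt_of_le_of_lt (not_lt.1 hx) ha)]; ring
  have hz3 : ∀ x, x ∉ Ioi (0 : ℝ) → M x * deriv f x * deriv g x = 0 := fun x hx => by
    rw [hdga x (lt_of_le_of_lt (not_lt.1 hx) ha)]; ring
  rw [setIntegral_eq_integral_of_forall_compl_eq_zero hz1, setIntegral_eq_integral_of_forall_compl_eq_zero hz2,
    setIntegral_eq_integral_of_forall_compl_eq_zero hz3]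
  -- integrability
  have c1 : Continuous fun x => deriv M x * deriv f x * g x := by
    have hq : ContDiff ℝ 0 fun x => deriv f x * g x := contDiff_zero.2 (hdfc.mul hgc)
    have := (contDiff_weight_mul (n := 0) hM0 hq ha hPa).continuous
    exact this.congr fun x => by ring
  have c2 : Continuous fun x => M x * deriv (deriv f) x * g x := by
    have hq : ContDiff ℝ 0 fun x => deriv (deriv f) x * g x := contDiff_zero.2 (hd2fc.mul hgc)
    have := (contDiff_weight_mul (n := 0) (hM.of_le (by simp)) hq ha (fun x hx => by simp [hga x hx])).continuous
    exact this.congr fun x => by ring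
  have c3 : Continuous fun x => M x * deriv f x * deriv g x := by
    have hq : ContDiff ℝ 0 fun x => deriv f x * deriv g x := contDiff_zero.2 (hdfc.mul hdgc)
    have := (contDiff_weight_mul (n := 0) (hM.of_le (by simp)) hq ha (fun x hx => by simp [hdga x hx])).continuous
    exact this.congr fun x => by ring
  have s1 : HasCompactSupport fun x => deriv M x * deriv f x * g x := hs.mul_left
  have s2 : HasCompactSupport fun x => M x * deriv (deriv f) x * g x := hs.mul_left
  have s3 : HasCompactSupport fun x => M x * deriv f x * deriv g x := hs.deriv.mul_left
  have i1 : Integrable fun x => deriv M x * deriv f x * g x := c1.integrable_of_hasCompactSupport s1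
  have i2 : Integrable fun x => M x * deriv (deriv f) x * g x := c2.integrable_of_hasCompactSupport s2
  have i3 : Integrable fun x => M x * deriv f x * deriv g x := c3.integrable_of_hasCompactSupport s3
  have i23 : Integrable fun x => M x * deriv (deriv f) x * g x + M x * deriv f x * deriv g x := i2.add i3
  rw [integral_add i1 i23, integral_add i2 i3] at h0
  linarith

/-! ### Common one-dimensional facts on the quarter period -/

/-- For `h ∈ C¹` with `h(0) = 0`: `|cos θ·h(θ)| ≤ K sin(2θ)` on `[0, π/2]` for some `K ≥ 0`
(`|h| ≤ Mθ` and `θ cos θ ≤ (π/4) sin 2θ`). [folklore] -/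
theorem exists_abs_cos_mul_le_sin_two_mul {h : ℝ → ℝ} (hh : ContDiff ℝ 1 h) (h0 : h 0 = 0) :
    ∃ K, 0 ≤ K ∧ ∀ θ ∈ Icc 0 (π / 2), |Real.cos θ * h θ| ≤ K * Real.sin (2 * θ) := by
  obtain ⟨M, hM0, hM⟩ := exists_abs_le_mul_of_deriv hh h0 (π / 2)
  refine ⟨M * (π / 4), by positivity, fun θ hθ => ?_⟩
  have hc : 0 ≤ Real.cos θ := Real.cos_nonneg_of_mem_Icc ⟨by linarith [hθ.1, Real.pi_pos], hθ.2⟩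
  have hj : 2 / π * θ ≤ Real.sin θ := Real.mul_le_sin hθ.1 hθ.2
  have h1 := hM θ (by rw [abs_of_nonneg hθ.1]; exact hθ.2)
  rw [abs_of_nonneg hθ.1] at h1
  rw [abs_mul, abs_of_nonneg hc, Real.sin_two_mul]
  have hθle : θ ≤ π / 2 * Real.sin θ := by
    have := mul_le_mul_of_nonneg_left hj (by positivity : (0 : ℝ) ≤ π / 2)
    calc θ = π / 2 * (2 / π * θ) := by field_simp
      _ ≤ _ := this
  calc Real.cos θ * |h θ| ≤ Real.cos θ * (M * θ) := mul_le_mul_of_nonneg_left h1 hc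
    _ ≤ Real.cos θ * (M * (π / 2 * Real.sin θ)) :=
        mul_le_mul_of_nonneg_left (mul_le_mul_of_nonneg_left hθle hM0) hc
    _ = M * (π / 4) * (2 * Real.sin θ * Real.cos θ) := by ring

/-- An a.e.-strongly measurable `Φ` with `|Φ| ≤ C sin(2θ)^{−η}` on `(0, π/2)` is integrable there,
`0 ≤ η < 1`. [folklore] -/
theorem integrableOn_Ioo_of_abs_le_mul_rpow {η : ℝ} (hη0 : 0 ≤ η) (hη1 : η < 1) {Φ : ℝ → ℝ}
    (hm : AEStronglyMeasurable Φ (volume.restrict (Ioo 0 (π / 2)))) {C : ℝ}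
    (h : ∀ θ ∈ Ioo 0 (π / 2), |Φ θ| ≤ C * Real.sin (2 * θ) ^ (-η)) :
    IntegrableOn Φ (Ioo 0 (π / 2)) := by
  have iu := integrableOn_sin_two_mul_rpow (r := -η) (by linarith) (by linarith)
  refine Integrable.mono' (iu.const_mul C) hm ?_
  rw [ae_restrict_iff' measurableSet_Ioo]
  exact Filter.Eventually.of_forall fun θ hθ => by rw [Real.norm_eq_abs]; exact h θ hθ

/-- `|ab| ≤ AB` from `|a| ≤ A`, `|b| ≤ B`, `A ≥ 0`. [folklore] -/
theorem abs_mul₂_le {a b A B : ℝ} (ha : |a| ≤ A) (hb : |b| ≤ B) (hA : 0 ≤ A) : |a * b| ≤ A * B := by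
  rw [abs_mul]; exact mul_le_mul ha hb (abs_nonneg _) hA

/-- `|abc| ≤ ABC` from the three bounds, `A, B ≥ 0`. [folklore] -/
theorem abs_mul₃_le {a b c A B C : ℝ} (ha : |a| ≤ A) (hb : |b| ≤ B) (hc : |c| ≤ C) (hA : 0 ≤ A)
    (hB : 0 ≤ B) : |a * b * c| ≤ A * B * C := by
  rw [abs_mul]; exact mul_le_mul (abs_mul₂_le ha hb hA) hc (abs_nonneg _) (mul_nonneg hA hB)

/-- `|abcd| ≤ ABCD` from the four bounds, `A, B, C ≥ 0`. [folklore] -/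
theorem abs_mul₄_le {a b c d A B C D : ℝ} (ha : |a| ≤ A) (hb : |b| ≤ B) (hc : |c| ≤ C) (hd : |d| ≤ D)
    (hA : 0 ≤ A) (hB : 0 ≤ B) (hC : 0 ≤ C) : |a * b * c * d| ≤ A * B * C * D := by
  rw [abs_mul]
  exact mul_le_mul (abs_mul₃_le ha hb hc hA hB) hd (abs_nonneg _) (mul_nonneg (mul_nonneg hA hB) hC)

/-! ### The singular integrations by parts in `θ` -/

section theta

variable {η : ℝ} (hη0 : 0 ≤ η) (hη1 : η < 1)
include hη0 hη1

/-- **L1**: `∫₀^{π/2} u f f″ = −∫₀^{π/2} u f′² + 2η∫₀^{π/2} c u s⁻¹ f f′` (`u = sin(2θ)^{−η}`,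
`s = sin 2θ`, `c = cos 2θ`) for `f ∈ C²(ℝ)` with `f(0) = f(π/2) = 0`: the boundary function
`u f f′ = O(sin(2θ)^{1−η})` vanishes at both ends. [cite: Elgindi2021, §7.3 proof of Proposition 7.7 Step 2, the integration by parts `−(R²∂_RΨ, ∂_{Rθθ}Ψ W) = (R²∂_{Rθ}Ψ, ∂_{Rθ}Ψ W) + (R²∂_RΨ, ∂_{Rθ}Ψ∂_θW)` (p. 21 of arXiv:1904.04795)] -/
theorem integral_Ioo_rpow_mul_mul_deriv2 {f : ℝ → ℝ} (hf : ContDiff ℝ 2 f) (h0 : f 0 = 0)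
    (h1 : f (π / 2) = 0) :
    ∫ θ in Ioo 0 (π / 2), Real.sin (2 * θ) ^ (-η) * f θ * deriv (deriv f) θ =
      -(∫ θ in Ioo 0 (π / 2), Real.sin (2 * θ) ^ (-η) * deriv f θ ^ 2) +
        2 * η * ∫ θ in Ioo 0 (π / 2), Real.cos (2 * θ) * Real.sin (2 * θ) ^ (-η) *
          (Real.sin (2 * θ))⁻¹ * f θ * deriv f θ := by
  have hf1 : ContDiff ℝ 1 f := hf.of_le (by norm_num)
  have hdf1 : ContDiff ℝ 1 (deriv f) := by have := hf.iterate_deriv' 1 1; simpa using this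
  have hd : Differentiable ℝ f := hf1.differentiable (by simp)
  have hdd : Differentiable ℝ (deriv f) := hdf1.differentiable (by simp)
  have hfc : Continuous f := hf1.continuous
  have hdc : Continuous (deriv f) := hdf1.continuous
  have hd2c : Continuous (deriv (deriv f)) := hdf1.continuous_deriv le_rfl
  obtain ⟨K, hK0, hK⟩ := exists_abs_le_mul_sin_two_mul hf1 h0 h1
  obtain ⟨M, hM'⟩ := isCompact_Icc.exists_bound_of_continuousOn (s := Icc 0 (π / 2)) hdc.continuousOn
  obtain ⟨M₂, hM₂'⟩ := isCompact_Icc.exists_bound_of_continuousOn (s := Icc 0 (π / 2)) hd2c.continuousOn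
  have hM0 : 0 ≤ M := (norm_nonneg _).trans (hM' 0 ⟨le_rfl, by positivity⟩)
  have hM : ∀ θ ∈ Ioo 0 (π / 2), |deriv f θ| ≤ M := fun θ hθ => by
    have := hM' θ (Ioo_subset_Icc_self hθ); rwa [Real.norm_eq_abs] at this
  have hM₂ : ∀ θ ∈ Ioo 0 (π / 2), |deriv (deriv f) θ| ≤ M₂ := fun θ hθ => by
    have := hM₂' θ (Ioo_subset_Icc_self hθ); rwa [Real.norm_eq_abs] at this
  have hsin : ∀ θ ∈ Ioo 0 (π / 2), 0 < Real.sin (2 * θ) := fun θ hθ =>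
    Real.sin_pos_of_pos_of_lt_pi (by linarith [hθ.1]) (by linarith [hθ.2])
  -- atomic bounds on `(0, π/2)`
  have hfs : ∀ θ ∈ Ioo 0 (π / 2), |f θ * (Real.sin (2 * θ))⁻¹| ≤ K := fun θ hθ => by
    rw [abs_mul, abs_of_pos (inv_pos.2 (hsin θ hθ)), ← div_eq_mul_inv, div_le_iff₀ (hsin θ hθ)]
    exact hK θ (Ioo_subset_Icc_self hθ)
  have hfK : ∀ θ ∈ Ioo 0 (π / 2), |f θ| ≤ K := fun θ hθ =>
    (hK θ (Ioo_subset_Icc_self hθ)).trans (by nlinarith [Real.sin_le_one (2 * θ)])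
  -- the derivative of the boundary function
  obtain ⟨Φ', hΦ'⟩ : ∃ Φ' : ℝ → ℝ, Φ' = fun θ => -(2 * η) * (Real.cos (2 * θ) * Real.sin (2 * θ) ^ (-η) *
      (Real.sin (2 * θ))⁻¹ * f θ * deriv f θ) + Real.sin (2 * θ) ^ (-η) * deriv f θ ^ 2 +
      Real.sin (2 * θ) ^ (-η) * f θ * deriv (deriv f) θ := ⟨_, rfl⟩
  have hderiv : ∀ θ ∈ Ioo 0 (π / 2),
      HasDerivAt (fun θ => Real.sin (2 * θ) ^ (-η) * f θ * deriv f θ) (Φ' θ) θ := by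
    intro θ hθ
    have hU := hasDerivAt_sin_two_mul_rpow (-η) hθ
    have hall := (hU.fun_mul (hd θ).hasDerivAt).fun_mul (hdd θ).hasDerivAt
    refine hall.congr_deriv ?_
    simp only [hΦ']
    ring
  have hΦ'b : ∀ θ ∈ Ioo 0 (π / 2), |Φ' θ| ≤ (2 * η * (K * M) + M * M + K * M₂) * Real.sin (2 * θ) ^ (-η) := by
    intro θ hθ
    have hs := hsin θ hθ
    have hu : 0 ≤ Real.sin (2 * θ) ^ (-η) := Real.rpow_nonneg hs.le _
    have hc1 := Real.abs_cos_le_one (2 * θ)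
    have t1 : |Real.cos (2 * θ) * Real.sin (2 * θ) ^ (-η) * (Real.sin (2 * θ))⁻¹ * f θ * deriv f θ| ≤
        K * M * Real.sin (2 * θ) ^ (-η) := by
      have e : Real.cos (2 * θ) * Real.sin (2 * θ) ^ (-η) * (Real.sin (2 * θ))⁻¹ * f θ * deriv f θ =
          (Real.cos (2 * θ) * (f θ * (Real.sin (2 * θ))⁻¹) * deriv f θ) * Real.sin (2 * θ) ^ (-η) := by ring
      rw [e, abs_mul, abs_of_nonneg hu]
      have hb := abs_mul₃_le hc1 (hfs θ hθ) (hM θ hθ) zero_le_one hK0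
      calc _ ≤ 1 * K * M * Real.sin (2 * θ) ^ (-η) := mul_le_mul_of_nonneg_right hb hu
        _ = _ := by ring
    have t2 : |Real.sin (2 * θ) ^ (-η) * deriv f θ ^ 2| ≤ M * M * Real.sin (2 * θ) ^ (-η) := by
      have e : Real.sin (2 * θ) ^ (-η) * deriv f θ ^ 2 = (deriv f θ * deriv f θ) * Real.sin (2 * θ) ^ (-η) := by ring
      rw [e, abs_mul, abs_of_nonneg hu]
      exact mul_le_mul_of_nonneg_right (abs_mul₂_le (hM θ hθ) (hM θ hθ) hM0) hu
    have t3 : |Real.sin (2 * θ) ^ (-η) * f θ * deriv (deriv f) θ| ≤ K * M₂ * Real.sin (2 * θ) ^ (-η) := by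
      have e : Real.sin (2 * θ) ^ (-η) * f θ * deriv (deriv f) θ = (f θ * deriv (deriv f) θ) * Real.sin (2 * θ) ^ (-η) := by ring
      rw [e, abs_mul, abs_of_nonneg hu]
      exact mul_le_mul_of_nonneg_right (abs_mul₂_le (hfK θ hθ) (hM₂ θ hθ) hK0) hu
    simp only [hΦ']
    calc _ ≤ |-(2 * η) * (Real.cos (2 * θ) * Real.sin (2 * θ) ^ (-η) * (Real.sin (2 * θ))⁻¹ * f θ * deriv f θ)| +
          |Real.sin (2 * θ) ^ (-η) * deriv f θ ^ 2| + |Real.sin (2 * θ) ^ (-η) * f θ * deriv (deriv f) θ| :=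
          abs_add_three _ _ _
      _ ≤ 2 * η * (K * M * Real.sin (2 * θ) ^ (-η)) + M * M * Real.sin (2 * θ) ^ (-η) +
          K * M₂ * Real.sin (2 * θ) ^ (-η) := by
          rw [abs_mul, abs_neg, abs_of_nonneg (by positivity : (0 : ℝ) ≤ 2 * η)]
          gcongr
      _ = _ := by ring
  have hΦb : ∀ θ ∈ Ioo 0 (π / 2), |Real.sin (2 * θ) ^ (-η) * f θ * deriv f θ| ≤ K * M * Real.sin (2 * θ) ^ (1 - η) := by
    intro θ hθ
    have hs := hsin θ hθ
    have hu : 0 ≤ Real.sin (2 * θ) ^ (-η) := Real.rpow_nonneg hs.le _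
    have e : Real.sin (2 * θ) ^ (1 - η) = Real.sin (2 * θ) * Real.sin (2 * θ) ^ (-η) := by
      rw [sub_eq_add_neg, Real.rpow_add hs, Real.rpow_one]
    have e2 : Real.sin (2 * θ) ^ (-η) * f θ * deriv f θ = (f θ * deriv f θ) * Real.sin (2 * θ) ^ (-η) := by ring
    rw [e, e2, abs_mul, abs_of_nonneg hu]
    have hb := abs_mul₂_le (hK θ (Ioo_subset_Icc_self hθ)) (hM θ hθ) (by positivity)
    calc _ ≤ K * Real.sin (2 * θ) * M * Real.sin (2 * θ) ^ (-η) := mul_le_mul_of_nonneg_right hb hu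
      _ = _ := by ring
  -- integrability of the three pieces and of `Φ'`
  have hum : Measurable fun θ : ℝ => Real.sin (2 * θ) ^ (-η) :=
    (by fun_prop : Measurable fun θ : ℝ => Real.sin (2 * θ)).pow_const _
  have hfm : Measurable f := hfc.measurable
  have hdm : Measurable (deriv f) := hdc.measurable
  have hd2m : Measurable (deriv (deriv f)) := hd2c.measurable
  have hmΦ' : Measurable Φ' := by rw [hΦ']; fun_prop
  have iΦ' : IntegrableOn Φ' (Ioo 0 (π / 2)) :=
    integrableOn_Ioo_of_abs_le_mul_rpow hη0 hη1 hmΦ'.aestronglyMeasurable hΦ'b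
  have iA : IntegrableOn (fun θ => Real.cos (2 * θ) * Real.sin (2 * θ) ^ (-η) * (Real.sin (2 * θ))⁻¹ * f θ *
      deriv f θ) (Ioo 0 (π / 2)) := by
    refine integrableOn_Ioo_of_abs_le_mul_rpow hη0 hη1 (C := K * M) ?_ ?_
    · exact (by fun_prop : Measurable fun θ => Real.cos (2 * θ) * Real.sin (2 * θ) ^ (-η) *
        (Real.sin (2 * θ))⁻¹ * f θ * deriv f θ).aestronglyMeasurable
    · intro θ hθ
      have hu : 0 ≤ Real.sin (2 * θ) ^ (-η) := Real.rpow_nonneg (hsin θ hθ).le _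
      have e : Real.cos (2 * θ) * Real.sin (2 * θ) ^ (-η) * (Real.sin (2 * θ))⁻¹ * f θ * deriv f θ =
          (Real.cos (2 * θ) * (f θ * (Real.sin (2 * θ))⁻¹) * deriv f θ) * Real.sin (2 * θ) ^ (-η) := by ring
      rw [e, abs_mul, abs_of_nonneg hu]
      have hb := abs_mul₃_le (Real.abs_cos_le_one (2 * θ)) (hfs θ hθ) (hM θ hθ) zero_le_one hK0
      calc _ ≤ 1 * K * M * Real.sin (2 * θ) ^ (-η) := mul_le_mul_of_nonneg_right hb hu
        _ = _ := by ring
  have iB : IntegrableOn (fun θ => Real.sin (2 * θ) ^ (-η) * deriv f θ ^ 2) (Ioo 0 (π / 2)) :=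
    (integrableOn_deriv_sq_mul_rpow hη0 hη1 hf1).congr (ae_of_all _ fun θ => by ring)
  have iC : IntegrableOn (fun θ => Real.sin (2 * θ) ^ (-η) * f θ * deriv (deriv f) θ) (Ioo 0 (π / 2)) := by
    refine integrableOn_Ioo_of_abs_le_mul_rpow hη0 hη1 (C := K * M₂) ?_ ?_
    · exact (by fun_prop : Measurable fun θ => Real.sin (2 * θ) ^ (-η) * f θ * deriv (deriv f) θ).aestronglyMeasurable
    · intro θ hθ
      have hu : 0 ≤ Real.sin (2 * θ) ^ (-η) := Real.rpow_nonneg (hsin θ hθ).le _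
      have e : Real.sin (2 * θ) ^ (-η) * f θ * deriv (deriv f) θ = (f θ * deriv (deriv f) θ) * Real.sin (2 * θ) ^ (-η) := by ring
      rw [e, abs_mul, abs_of_nonneg hu]
      exact mul_le_mul_of_nonneg_right (abs_mul₂_le (hfK θ hθ) (hM₂ θ hθ) hK0) hu
  -- `∫ Φ' = 0`
  have h0' := integral_Ioo_eq_zero_of_hasDerivAt_of_abs_le_rpow (by linarith : (0 : ℝ) < 1 - η) hderiv iΦ' hΦb
  have e : ∫ θ in Ioo 0 (π / 2), Φ' θ = -(2 * η) * (∫ θ in Ioo 0 (π / 2), Real.cos (2 * θ) * Real.sin (2 * θ) ^ (-η) *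
      (Real.sin (2 * θ))⁻¹ * f θ * deriv f θ) + (∫ θ in Ioo 0 (π / 2), Real.sin (2 * θ) ^ (-η) * deriv f θ ^ 2) +
      ∫ θ in Ioo 0 (π / 2), Real.sin (2 * θ) ^ (-η) * f θ * deriv (deriv f) θ := by
    have i1 : IntegrableOn (fun θ => -(2 * η) * (Real.cos (2 * θ) * Real.sin (2 * θ) ^ (-η) *
        (Real.sin (2 * θ))⁻¹ * f θ * deriv f θ)) (Ioo 0 (π / 2)) := iA.const_mul _
    have i12 : IntegrableOn (fun θ => -(2 * η) * (Real.cos (2 * θ) * Real.sin (2 * θ) ^ (-η) *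
        (Real.sin (2 * θ))⁻¹ * f θ * deriv f θ) + Real.sin (2 * θ) ^ (-η) * deriv f θ ^ 2) (Ioo 0 (π / 2)) := i1.add iB
    rw [hΦ', integral_add i12 iC, integral_add i1 iB, MeasureTheory.integral_const_mul]
  rw [e] at h0'
  linarith

/-- **L2** (the `∂_θθ sin(2θ)^{−η}` display): `∫₀^{π/2} c u s⁻¹ f f′ = ∫₀^{π/2} u f² +
(1+η)∫₀^{π/2} c² u (f/s)²` for `f ∈ C¹(ℝ)` with `f(0) = f(π/2) = 0` (boundary function
`½ c u f²/s = O(sin(2θ)^{1−η})`; equivalently `∫ u′ f f′ = −½∫ u″ f²` with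
`u″ = 4η(η+1)c²u/s² + 4ηu`). [cite: Elgindi2021, §7.3 proof of Proposition 7.7 Step 2, display "Observe that ∂_θθ(1/sin(2θ)^η) = 4η(η+1)cos²(2θ)/sin^{2+η}(2θ) + 4η/sin^η(2θ)" (p. 21 of arXiv:1904.04795)] -/
theorem integral_Ioo_cos_rpow_inv_mul_mul_deriv {f : ℝ → ℝ} (hf : ContDiff ℝ 1 f) (h0 : f 0 = 0)
    (h1 : f (π / 2) = 0) :
    ∫ θ in Ioo 0 (π / 2), Real.cos (2 * θ) * Real.sin (2 * θ) ^ (-η) * (Real.sin (2 * θ))⁻¹ * f θ * deriv f θ =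
      (∫ θ in Ioo 0 (π / 2), Real.sin (2 * θ) ^ (-η) * f θ ^ 2) +
        (1 + η) * ∫ θ in Ioo 0 (π / 2), Real.cos (2 * θ) ^ 2 * Real.sin (2 * θ) ^ (-η) *
          (f θ / Real.sin (2 * θ)) ^ 2 := by
  have hd : Differentiable ℝ f := hf.differentiable (by simp)
  have hfc : Continuous f := hf.continuous
  have hdc : Continuous (deriv f) := hf.continuous_deriv le_rfl
  obtain ⟨K, hK0, hK⟩ := exists_abs_le_mul_sin_two_mul hf h0 h1
  obtain ⟨M, hM'⟩ := isCompact_Icc.exists_bound_of_continuousOn (s := Icc 0 (π / 2)) hdc.continuousOn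
  have hM0 : 0 ≤ M := (norm_nonneg _).trans (hM' 0 ⟨le_rfl, by positivity⟩)
  have hM : ∀ θ ∈ Ioo 0 (π / 2), |deriv f θ| ≤ M := fun θ hθ => by
    have := hM' θ (Ioo_subset_Icc_self hθ); rwa [Real.norm_eq_abs] at this
  have hsin : ∀ θ ∈ Ioo 0 (π / 2), 0 < Real.sin (2 * θ) := fun θ hθ =>
    Real.sin_pos_of_pos_of_lt_pi (by linarith [hθ.1]) (by linarith [hθ.2])
  have hfs : ∀ θ ∈ Ioo 0 (π / 2), |f θ * (Real.sin (2 * θ))⁻¹| ≤ K := fun θ hθ => by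
    rw [abs_mul, abs_of_pos (inv_pos.2 (hsin θ hθ)), ← div_eq_mul_inv, div_le_iff₀ (hsin θ hθ)]
    exact hK θ (Ioo_subset_Icc_self hθ)
  have hfs' : ∀ θ ∈ Ioo 0 (π / 2), |f θ / Real.sin (2 * θ)| ≤ K := fun θ hθ => by
    rw [div_eq_mul_inv]; exact hfs θ hθ
  have hfK : ∀ θ ∈ Ioo 0 (π / 2), |f θ| ≤ K := fun θ hθ =>
    (hK θ (Ioo_subset_Icc_self hθ)).trans (by nlinarith [Real.sin_le_one (2 * θ)])
  obtain ⟨Φ', hΦ'⟩ : ∃ Φ' : ℝ → ℝ, Φ' = fun θ => -(Real.sin (2 * θ) ^ (-η) * f θ ^ 2) -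
      (1 + η) * (Real.cos (2 * θ) ^ 2 * Real.sin (2 * θ) ^ (-η) * (f θ / Real.sin (2 * θ)) ^ 2) +
      Real.cos (2 * θ) * Real.sin (2 * θ) ^ (-η) * (Real.sin (2 * θ))⁻¹ * f θ * deriv f θ := ⟨_, rfl⟩
  have hderiv : ∀ θ ∈ Ioo 0 (π / 2), HasDerivAt (fun θ => (1 / 2) * Real.cos (2 * θ) * Real.sin (2 * θ) ^ (-η) *
      (Real.sin (2 * θ))⁻¹ * f θ ^ 2) (Φ' θ) θ := by
    intro θ hθ
    have hs := hsin θ hθ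
    have hsne : Real.sin (2 * θ) ≠ 0 := hs.ne'
    have h2 : HasDerivAt (fun x : ℝ => 2 * x) 2 θ := by
      simpa using (hasDerivAt_id' θ).const_mul (2 : ℝ)
    have hS : HasDerivAt (fun x => Real.sin (2 * x)) (Real.cos (2 * θ) * 2) θ := h2.sin
    have hC : HasDerivAt (fun x => Real.cos (2 * x)) (-Real.sin (2 * θ) * 2) θ := h2.cos
    have hU := hasDerivAt_sin_two_mul_rpow (-η) hθ
    have hI : HasDerivAt (fun x => (Real.sin (2 * x))⁻¹)
        (-(Real.cos (2 * θ) * 2) / Real.sin (2 * θ) ^ 2) θ := hS.fun_inv hsne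
    have e2 : (fun y => f y ^ 2) = fun y => f y * f y := by funext y; ring
    have hP : HasDerivAt (fun y => f y ^ 2) (deriv f θ * f θ + f θ * deriv f θ) θ := by
      rw [e2]; exact (hd θ).hasDerivAt.fun_mul (hd θ).hasDerivAt
    have hall := ((((hC.const_mul (1 / 2 : ℝ)).fun_mul hU).fun_mul hI).fun_mul hP)
    refine hall.congr_deriv ?_
    simp only [hΦ']
    field_simp
    ring
  have hΦ'b : ∀ θ ∈ Ioo 0 (π / 2), |Φ' θ| ≤ (K * K + (1 + η) * (K * K) + K * M) * Real.sin (2 * θ) ^ (-η) := by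
    intro θ hθ
    have hs := hsin θ hθ
    have hu : 0 ≤ Real.sin (2 * θ) ^ (-η) := Real.rpow_nonneg hs.le _
    have hc1 := Real.abs_cos_le_one (2 * θ)
    have t1 : |-(Real.sin (2 * θ) ^ (-η) * f θ ^ 2)| ≤ K * K * Real.sin (2 * θ) ^ (-η) := by
      have e : -(Real.sin (2 * θ) ^ (-η) * f θ ^ 2) = -((f θ * f θ) * Real.sin (2 * θ) ^ (-η)) := by ring
      rw [e, abs_neg, abs_mul, abs_of_nonneg hu]
      exact mul_le_mul_of_nonneg_right (abs_mul₂_le (hfK θ hθ) (hfK θ hθ) hK0) hu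
    have t2 : |(1 + η) * (Real.cos (2 * θ) ^ 2 * Real.sin (2 * θ) ^ (-η) * (f θ / Real.sin (2 * θ)) ^ 2)| ≤
        (1 + η) * (K * K) * Real.sin (2 * θ) ^ (-η) := by
      have e : (1 + η) * (Real.cos (2 * θ) ^ 2 * Real.sin (2 * θ) ^ (-η) * (f θ / Real.sin (2 * θ)) ^ 2) =
          (1 + η) * ((Real.cos (2 * θ) * Real.cos (2 * θ) * (f θ / Real.sin (2 * θ)) * (f θ / Real.sin (2 * θ))) *
            Real.sin (2 * θ) ^ (-η)) := by ring
      rw [e, abs_mul, abs_of_nonneg (by linarith : (0 : ℝ) ≤ 1 + η), abs_mul, abs_of_nonneg hu]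
      have hb := abs_mul₄_le hc1 hc1 (hfs' θ hθ) (hfs' θ hθ) zero_le_one zero_le_one hK0
      have := mul_le_mul_of_nonneg_right hb hu
      have h1η : (0 : ℝ) ≤ 1 + η := by linarith
      calc _ ≤ (1 + η) * (1 * 1 * K * K * Real.sin (2 * θ) ^ (-η)) := mul_le_mul_of_nonneg_left this h1η
        _ = _ := by ring
    have t3 : |Real.cos (2 * θ) * Real.sin (2 * θ) ^ (-η) * (Real.sin (2 * θ))⁻¹ * f θ * deriv f θ| ≤
        K * M * Real.sin (2 * θ) ^ (-η) := by
      have e : Real.cos (2 * θ) * Real.sin (2 * θ) ^ (-η) * (Real.sin (2 * θ))⁻¹ * f θ * deriv f θ =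
          (Real.cos (2 * θ) * (f θ * (Real.sin (2 * θ))⁻¹) * deriv f θ) * Real.sin (2 * θ) ^ (-η) := by ring
      rw [e, abs_mul, abs_of_nonneg hu]
      have hb := abs_mul₃_le hc1 (hfs θ hθ) (hM θ hθ) zero_le_one hK0
      calc _ ≤ 1 * K * M * Real.sin (2 * θ) ^ (-η) := mul_le_mul_of_nonneg_right hb hu
        _ = _ := by ring
    simp only [hΦ']
    calc _ ≤ |-(Real.sin (2 * θ) ^ (-η) * f θ ^ 2) -
          (1 + η) * (Real.cos (2 * θ) ^ 2 * Real.sin (2 * θ) ^ (-η) * (f θ / Real.sin (2 * θ)) ^ 2)| +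
          |Real.cos (2 * θ) * Real.sin (2 * θ) ^ (-η) * (Real.sin (2 * θ))⁻¹ * f θ * deriv f θ| := abs_add_le _ _
      _ ≤ |-(Real.sin (2 * θ) ^ (-η) * f θ ^ 2)| +
          |(1 + η) * (Real.cos (2 * θ) ^ 2 * Real.sin (2 * θ) ^ (-η) * (f θ / Real.sin (2 * θ)) ^ 2)| +
          |Real.cos (2 * θ) * Real.sin (2 * θ) ^ (-η) * (Real.sin (2 * θ))⁻¹ * f θ * deriv f θ| :=
          by gcongr ?_ + _; exact abs_sub _ _
      _ ≤ _ := by linarith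
  have hΦb : ∀ θ ∈ Ioo 0 (π / 2), |(1 / 2) * Real.cos (2 * θ) * Real.sin (2 * θ) ^ (-η) *
      (Real.sin (2 * θ))⁻¹ * f θ ^ 2| ≤ (1 / 2) * (K * K) * Real.sin (2 * θ) ^ (1 - η) := by
    intro θ hθ
    have hs := hsin θ hθ
    have hu : 0 ≤ Real.sin (2 * θ) ^ (-η) := Real.rpow_nonneg hs.le _
    have e : Real.sin (2 * θ) ^ (1 - η) = Real.sin (2 * θ) * Real.sin (2 * θ) ^ (-η) := by
      rw [sub_eq_add_neg, Real.rpow_add hs, Real.rpow_one]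
    have e2 : (1 / 2) * Real.cos (2 * θ) * Real.sin (2 * θ) ^ (-η) * (Real.sin (2 * θ))⁻¹ * f θ ^ 2 =
        (1 / 2) * ((Real.cos (2 * θ) * (f θ * (Real.sin (2 * θ))⁻¹) * f θ) * Real.sin (2 * θ) ^ (-η)) := by ring
    rw [e, e2, abs_mul, abs_of_nonneg (by norm_num : (0 : ℝ) ≤ 1 / 2), abs_mul, abs_of_nonneg hu]
    have hb := abs_mul₃_le (Real.abs_cos_le_one (2 * θ)) (hfs θ hθ) (hK θ (Ioo_subset_Icc_self hθ)) zero_le_one hK0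
    have := mul_le_mul_of_nonneg_right hb hu
    calc _ ≤ (1 / 2) * (1 * K * (K * Real.sin (2 * θ)) * Real.sin (2 * θ) ^ (-η)) :=
          mul_le_mul_of_nonneg_left this (by norm_num)
      _ = _ := by ring
  have hum : Measurable fun θ : ℝ => Real.sin (2 * θ) ^ (-η) :=
    (by fun_prop : Measurable fun θ : ℝ => Real.sin (2 * θ)).pow_const _
  have hfm : Measurable f := hfc.measurable
  have hdm : Measurable (deriv f) := hdc.measurable
  have hmΦ' : Measurable Φ' := by rw [hΦ']; fun_prop
  have iΦ' : IntegrableOn Φ' (Ioo 0 (π / 2)) :=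
    integrableOn_Ioo_of_abs_le_mul_rpow hη0 hη1 hmΦ'.aestronglyMeasurable hΦ'b
  have iA : IntegrableOn (fun θ => Real.sin (2 * θ) ^ (-η) * f θ ^ 2) (Ioo 0 (π / 2)) :=
    (integrableOn_sq_mul_rpow hη0 hη1 hfc).congr (ae_of_all _ fun θ => by ring)
  have iB : IntegrableOn (fun θ => Real.cos (2 * θ) ^ 2 * Real.sin (2 * θ) ^ (-η) *
      (f θ / Real.sin (2 * θ)) ^ 2) (Ioo 0 (π / 2)) := by
    refine integrableOn_Ioo_of_abs_le_mul_rpow hη0 hη1 (C := K * K) ?_ ?_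
    · exact (by fun_prop : Measurable fun θ => Real.cos (2 * θ) ^ 2 * Real.sin (2 * θ) ^ (-η) *
        (f θ / Real.sin (2 * θ)) ^ 2).aestronglyMeasurable
    · intro θ hθ
      have hu : 0 ≤ Real.sin (2 * θ) ^ (-η) := Real.rpow_nonneg (hsin θ hθ).le _
      have e : Real.cos (2 * θ) ^ 2 * Real.sin (2 * θ) ^ (-η) * (f θ / Real.sin (2 * θ)) ^ 2 =
          (Real.cos (2 * θ) * Real.cos (2 * θ) * (f θ / Real.sin (2 * θ)) * (f θ / Real.sin (2 * θ))) *
            Real.sin (2 * θ) ^ (-η) := by ring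
      rw [e, abs_mul, abs_of_nonneg hu]
      have hb := abs_mul₄_le (Real.abs_cos_le_one (2 * θ)) (Real.abs_cos_le_one (2 * θ)) (hfs' θ hθ) (hfs' θ hθ)
        zero_le_one zero_le_one hK0
      calc _ ≤ 1 * 1 * K * K * Real.sin (2 * θ) ^ (-η) := mul_le_mul_of_nonneg_right hb hu
        _ = _ := by ring
  have iC : IntegrableOn (fun θ => Real.cos (2 * θ) * Real.sin (2 * θ) ^ (-η) * (Real.sin (2 * θ))⁻¹ * f θ *
      deriv f θ) (Ioo 0 (π / 2)) := by
    refine integrableOn_Ioo_of_abs_le_mul_rpow hη0 hη1 (C := K * M) ?_ ?_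
    · exact (by fun_prop : Measurable fun θ => Real.cos (2 * θ) * Real.sin (2 * θ) ^ (-η) *
        (Real.sin (2 * θ))⁻¹ * f θ * deriv f θ).aestronglyMeasurable
    · intro θ hθ
      have hu : 0 ≤ Real.sin (2 * θ) ^ (-η) := Real.rpow_nonneg (hsin θ hθ).le _
      have e : Real.cos (2 * θ) * Real.sin (2 * θ) ^ (-η) * (Real.sin (2 * θ))⁻¹ * f θ * deriv f θ =
          (Real.cos (2 * θ) * (f θ * (Real.sin (2 * θ))⁻¹) * deriv f θ) * Real.sin (2 * θ) ^ (-η) := by ring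
      rw [e, abs_mul, abs_of_nonneg hu]
      have hb := abs_mul₃_le (Real.abs_cos_le_one (2 * θ)) (hfs θ hθ) (hM θ hθ) zero_le_one hK0
      calc _ ≤ 1 * K * M * Real.sin (2 * θ) ^ (-η) := mul_le_mul_of_nonneg_right hb hu
        _ = _ := by ring
  have h0' := integral_Ioo_eq_zero_of_hasDerivAt_of_abs_le_rpow (by linarith : (0 : ℝ) < 1 - η) hderiv iΦ' hΦb
  have e : ∫ θ in Ioo 0 (π / 2), Φ' θ = -(∫ θ in Ioo 0 (π / 2), Real.sin (2 * θ) ^ (-η) * f θ ^ 2) -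
      (1 + η) * (∫ θ in Ioo 0 (π / 2), Real.cos (2 * θ) ^ 2 * Real.sin (2 * θ) ^ (-η) * (f θ / Real.sin (2 * θ)) ^ 2) +
      ∫ θ in Ioo 0 (π / 2), Real.cos (2 * θ) * Real.sin (2 * θ) ^ (-η) * (Real.sin (2 * θ))⁻¹ * f θ * deriv f θ := by
    have i1 : IntegrableOn (fun θ => -(Real.sin (2 * θ) ^ (-η) * f θ ^ 2)) (Ioo 0 (π / 2)) := iA.neg
    have i2 : IntegrableOn (fun θ => (1 + η) * (Real.cos (2 * θ) ^ 2 * Real.sin (2 * θ) ^ (-η) *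
        (f θ / Real.sin (2 * θ)) ^ 2)) (Ioo 0 (π / 2)) := iB.const_mul _
    have i12 : IntegrableOn (fun θ => -(Real.sin (2 * θ) ^ (-η) * f θ ^ 2) -
        (1 + η) * (Real.cos (2 * θ) ^ 2 * Real.sin (2 * θ) ^ (-η) * (f θ / Real.sin (2 * θ)) ^ 2)) (Ioo 0 (π / 2)) :=
      i1.sub i2
    rw [hΦ', integral_add i12 iC, integral_sub i1 i2, MeasureTheory.integral_neg, MeasureTheory.integral_const_mul]
  rw [e] at h0'
  linarith

/-- **L3** (the `I_{4,1}` display): `∫₀^{π/2} s u g g′ = −(1−η)∫₀^{π/2} c u g²` for any `g ∈ C¹(ℝ)`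
(boundary function `½ s u g² = O(sin(2θ)^{1−η})`). [cite: Elgindi2021, §7.3 proof of Proposition 7.7 Step 2, display `I_{4,1} = ((1−η)/2)(cos(2θ)(∂_θΨ̄)², w²/sin^η(2θ))` (p. 22 of arXiv:1904.04795)] -/
theorem integral_Ioo_sin_rpow_mul_mul_deriv {g : ℝ → ℝ} (hg : ContDiff ℝ 1 g) :
    ∫ θ in Ioo 0 (π / 2), Real.sin (2 * θ) * Real.sin (2 * θ) ^ (-η) * g θ * deriv g θ =
      -(1 - η) * ∫ θ in Ioo 0 (π / 2), Real.cos (2 * θ) * Real.sin (2 * θ) ^ (-η) * g θ ^ 2 := by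
  have hd : Differentiable ℝ g := hg.differentiable (by simp)
  have hgc : Continuous g := hg.continuous
  have hdc : Continuous (deriv g) := hg.continuous_deriv le_rfl
  obtain ⟨G, hG'⟩ := isCompact_Icc.exists_bound_of_continuousOn (s := Icc 0 (π / 2)) hgc.continuousOn
  obtain ⟨M, hM'⟩ := isCompact_Icc.exists_bound_of_continuousOn (s := Icc 0 (π / 2)) hdc.continuousOn
  have hG0 : 0 ≤ G := (norm_nonneg _).trans (hG' 0 ⟨le_rfl, by positivity⟩)
  have hG : ∀ θ ∈ Ioo 0 (π / 2), |g θ| ≤ G := fun θ hθ => by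
    have := hG' θ (Ioo_subset_Icc_self hθ); rwa [Real.norm_eq_abs] at this
  have hM : ∀ θ ∈ Ioo 0 (π / 2), |deriv g θ| ≤ M := fun θ hθ => by
    have := hM' θ (Ioo_subset_Icc_self hθ); rwa [Real.norm_eq_abs] at this
  have hsin : ∀ θ ∈ Ioo 0 (π / 2), 0 < Real.sin (2 * θ) := fun θ hθ =>
    Real.sin_pos_of_pos_of_lt_pi (by linarith [hθ.1]) (by linarith [hθ.2])
  have hs1 : ∀ θ : ℝ, |Real.sin (2 * θ)| ≤ 1 := fun θ => Real.abs_sin_le_one _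
  obtain ⟨Φ', hΦ'⟩ : ∃ Φ' : ℝ → ℝ, Φ' = fun θ => (1 - η) * (Real.cos (2 * θ) * Real.sin (2 * θ) ^ (-η) * g θ ^ 2) +
      Real.sin (2 * θ) * Real.sin (2 * θ) ^ (-η) * g θ * deriv g θ := ⟨_, rfl⟩
  have hderiv : ∀ θ ∈ Ioo 0 (π / 2),
      HasDerivAt (fun θ => (1 / 2) * Real.sin (2 * θ) * Real.sin (2 * θ) ^ (-η) * g θ ^ 2) (Φ' θ) θ := by
    intro θ hθ
    have hs := hsin θ hθ
    have hsne : Real.sin (2 * θ) ≠ 0 := hs.ne'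
    have h2 : HasDerivAt (fun x : ℝ => 2 * x) 2 θ := by
      simpa using (hasDerivAt_id' θ).const_mul (2 : ℝ)
    have hS : HasDerivAt (fun x => Real.sin (2 * x)) (Real.cos (2 * θ) * 2) θ := h2.sin
    have hU := hasDerivAt_sin_two_mul_rpow (-η) hθ
    have e2 : (fun y => g y ^ 2) = fun y => g y * g y := by funext y; ring
    have hP : HasDerivAt (fun y => g y ^ 2) (deriv g θ * g θ + g θ * deriv g θ) θ := by
      rw [e2]; exact (hd θ).hasDerivAt.fun_mul (hd θ).hasDerivAt
    have hall := (((hS.const_mul (1 / 2 : ℝ)).fun_mul hU).fun_mul hP)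
    refine hall.congr_deriv ?_
    simp only [hΦ']
    field_simp
    ring
  have hΦ'b : ∀ θ ∈ Ioo 0 (π / 2), |Φ' θ| ≤ ((1 - η) * (G * G) + G * M) * Real.sin (2 * θ) ^ (-η) := by
    intro θ hθ
    have hs := hsin θ hθ
    have hu : 0 ≤ Real.sin (2 * θ) ^ (-η) := Real.rpow_nonneg hs.le _
    have h1η : (0 : ℝ) ≤ 1 - η := by linarith
    have t1 : |(1 - η) * (Real.cos (2 * θ) * Real.sin (2 * θ) ^ (-η) * g θ ^ 2)| ≤
        (1 - η) * (G * G) * Real.sin (2 * θ) ^ (-η) := by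
      have e : (1 - η) * (Real.cos (2 * θ) * Real.sin (2 * θ) ^ (-η) * g θ ^ 2) =
          (1 - η) * ((Real.cos (2 * θ) * g θ * g θ) * Real.sin (2 * θ) ^ (-η)) := by ring
      rw [e, abs_mul, abs_of_nonneg h1η, abs_mul, abs_of_nonneg hu]
      have hb := abs_mul₃_le (Real.abs_cos_le_one (2 * θ)) (hG θ hθ) (hG θ hθ) zero_le_one hG0
      have := mul_le_mul_of_nonneg_right hb hu
      calc _ ≤ (1 - η) * (1 * G * G * Real.sin (2 * θ) ^ (-η)) := mul_le_mul_of_nonneg_left this h1η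
        _ = _ := by ring
    have t2 : |Real.sin (2 * θ) * Real.sin (2 * θ) ^ (-η) * g θ * deriv g θ| ≤ G * M * Real.sin (2 * θ) ^ (-η) := by
      have e : Real.sin (2 * θ) * Real.sin (2 * θ) ^ (-η) * g θ * deriv g θ =
          (Real.sin (2 * θ) * g θ * deriv g θ) * Real.sin (2 * θ) ^ (-η) := by ring
      rw [e, abs_mul, abs_of_nonneg hu]
      have hb := abs_mul₃_le (hs1 θ) (hG θ hθ) (hM θ hθ) zero_le_one hG0
      calc _ ≤ 1 * G * M * Real.sin (2 * θ) ^ (-η) := mul_le_mul_of_nonneg_right hb hu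
        _ = _ := by ring
    rw [hΦ']
    calc _ ≤ |(1 - η) * (Real.cos (2 * θ) * Real.sin (2 * θ) ^ (-η) * g θ ^ 2)| +
          |Real.sin (2 * θ) * Real.sin (2 * θ) ^ (-η) * g θ * deriv g θ| := abs_add_le _ _
      _ ≤ _ := by linarith
  have hΦb : ∀ θ ∈ Ioo 0 (π / 2), |(1 / 2) * Real.sin (2 * θ) * Real.sin (2 * θ) ^ (-η) * g θ ^ 2| ≤
      (1 / 2) * (G * G) * Real.sin (2 * θ) ^ (1 - η) := by
    intro θ hθ
    have hs := hsin θ hθ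
    have hu : 0 ≤ Real.sin (2 * θ) ^ (-η) := Real.rpow_nonneg hs.le _
    have e : Real.sin (2 * θ) ^ (1 - η) = Real.sin (2 * θ) * Real.sin (2 * θ) ^ (-η) := by
      rw [sub_eq_add_neg, Real.rpow_add hs, Real.rpow_one]
    have e2 : (1 / 2) * Real.sin (2 * θ) * Real.sin (2 * θ) ^ (-η) * g θ ^ 2 =
        (1 / 2) * ((g θ * g θ) * (Real.sin (2 * θ) * Real.sin (2 * θ) ^ (-η))) := by ring
    have hsu : 0 ≤ Real.sin (2 * θ) * Real.sin (2 * θ) ^ (-η) := mul_nonneg hs.le hu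
    rw [e, e2, abs_mul, abs_of_nonneg (by norm_num : (0 : ℝ) ≤ 1 / 2), abs_mul, abs_of_nonneg hsu]
    have hb := abs_mul₂_le (hG θ hθ) (hG θ hθ) hG0
    have := mul_le_mul_of_nonneg_right hb hsu
    calc _ ≤ (1 / 2) * (G * G * (Real.sin (2 * θ) * Real.sin (2 * θ) ^ (-η))) := mul_le_mul_of_nonneg_left this (by norm_num)
      _ = _ := by ring
  have hum : Measurable fun θ : ℝ => Real.sin (2 * θ) ^ (-η) :=
    (by fun_prop : Measurable fun θ : ℝ => Real.sin (2 * θ)).pow_const _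
  have hgm : Measurable g := hgc.measurable
  have hdm : Measurable (deriv g) := hdc.measurable
  have hmΦ' : Measurable Φ' := by rw [hΦ']; fun_prop
  have iΦ' : IntegrableOn Φ' (Ioo 0 (π / 2)) :=
    integrableOn_Ioo_of_abs_le_mul_rpow hη0 hη1 hmΦ'.aestronglyMeasurable hΦ'b
  have iA : IntegrableOn (fun θ => Real.cos (2 * θ) * Real.sin (2 * θ) ^ (-η) * g θ ^ 2) (Ioo 0 (π / 2)) := by
    refine integrableOn_Ioo_of_abs_le_mul_rpow hη0 hη1 (C := G * G) ?_ ?_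
    · exact (by fun_prop : Measurable fun θ => Real.cos (2 * θ) * Real.sin (2 * θ) ^ (-η) * g θ ^ 2).aestronglyMeasurable
    · intro θ hθ
      have hu : 0 ≤ Real.sin (2 * θ) ^ (-η) := Real.rpow_nonneg (hsin θ hθ).le _
      have e : Real.cos (2 * θ) * Real.sin (2 * θ) ^ (-η) * g θ ^ 2 = (Real.cos (2 * θ) * g θ * g θ) * Real.sin (2 * θ) ^ (-η) := by
        ring
      rw [e, abs_mul, abs_of_nonneg hu]
      have hb := abs_mul₃_le (Real.abs_cos_le_one (2 * θ)) (hG θ hθ) (hG θ hθ) zero_le_one hG0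
      calc _ ≤ 1 * G * G * Real.sin (2 * θ) ^ (-η) := mul_le_mul_of_nonneg_right hb hu
        _ = _ := by ring
  have iB : IntegrableOn (fun θ => Real.sin (2 * θ) * Real.sin (2 * θ) ^ (-η) * g θ * deriv g θ) (Ioo 0 (π / 2)) := by
    refine integrableOn_Ioo_of_abs_le_mul_rpow hη0 hη1 (C := G * M) ?_ ?_
    · exact (by fun_prop : Measurable fun θ => Real.sin (2 * θ) * Real.sin (2 * θ) ^ (-η) * g θ * deriv g θ).aestronglyMeasurable
    · intro θ hθ
      have hu : 0 ≤ Real.sin (2 * θ) ^ (-η) := Real.rpow_nonneg (hsin θ hθ).le _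
      have e : Real.sin (2 * θ) * Real.sin (2 * θ) ^ (-η) * g θ * deriv g θ =
          (Real.sin (2 * θ) * g θ * deriv g θ) * Real.sin (2 * θ) ^ (-η) := by ring
      rw [e, abs_mul, abs_of_nonneg hu]
      have hb := abs_mul₃_le (hs1 θ) (hG θ hθ) (hM θ hθ) zero_le_one hG0
      calc _ ≤ 1 * G * M * Real.sin (2 * θ) ^ (-η) := mul_le_mul_of_nonneg_right hb hu
        _ = _ := by ring
  have h0' := integral_Ioo_eq_zero_of_hasDerivAt_of_abs_le_rpow (by linarith : (0 : ℝ) < 1 - η) hderiv iΦ' hΦb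
  have e : ∫ θ in Ioo 0 (π / 2), Φ' θ = (1 - η) * (∫ θ in Ioo 0 (π / 2), Real.cos (2 * θ) * Real.sin (2 * θ) ^ (-η) * g θ ^ 2) +
      ∫ θ in Ioo 0 (π / 2), Real.sin (2 * θ) * Real.sin (2 * θ) ^ (-η) * g θ * deriv g θ := by
    have i1 : IntegrableOn (fun θ => (1 - η) * (Real.cos (2 * θ) * Real.sin (2 * θ) ^ (-η) * g θ ^ 2)) (Ioo 0 (π / 2)) :=
      iA.const_mul _
    rw [hΦ', integral_add i1 iB, MeasureTheory.integral_const_mul]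
  rw [e] at h0'
  linarith

/-- **L4**: `∫₀^{π/2} cos²θ u h h″ = −∫₀^{π/2} cos²θ u h′² + ∫₀^{π/2} s u h h′ + 2η∫₀^{π/2} c cos²θ u s⁻¹ h h′`
for `h ∈ C²(ℝ)` with `h(0) = 0` (boundary function `cos²θ u h h′ = O(sin(2θ)^{1−η})`; the
`sec(θ)Ψ`-terms of `I₄`). [cite: Elgindi2021, §7.3 proof of Proposition 7.7 Step 2, treatment of `I₄` via `Ψ̄ = Ψ/cos θ` (p. 21–22 of arXiv:1904.04795)] -/
theorem integral_Ioo_cos_sq_rpow_mul_mul_deriv2 {h : ℝ → ℝ} (hh : ContDiff ℝ 2 h) (h0 : h 0 = 0) :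
    ∫ θ in Ioo 0 (π / 2), Real.cos θ ^ 2 * Real.sin (2 * θ) ^ (-η) * h θ * deriv (deriv h) θ =
      -(∫ θ in Ioo 0 (π / 2), Real.cos θ ^ 2 * Real.sin (2 * θ) ^ (-η) * deriv h θ ^ 2) +
        (∫ θ in Ioo 0 (π / 2), Real.sin (2 * θ) * Real.sin (2 * θ) ^ (-η) * h θ * deriv h θ) +
        2 * η * ∫ θ in Ioo 0 (π / 2), Real.cos (2 * θ) * Real.cos θ ^ 2 * Real.sin (2 * θ) ^ (-η) *
          (Real.sin (2 * θ))⁻¹ * h θ * deriv h θ := by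
  have hh1 : ContDiff ℝ 1 h := hh.of_le (by norm_num)
  have hdh1 : ContDiff ℝ 1 (deriv h) := by have := hh.iterate_deriv' 1 1; simpa using this
  have hd : Differentiable ℝ h := hh1.differentiable (by simp)
  have hdd : Differentiable ℝ (deriv h) := hdh1.differentiable (by simp)
  have hhc : Continuous h := hh1.continuous
  have hdc : Continuous (deriv h) := hdh1.continuous
  have hd2c : Continuous (deriv (deriv h)) := hdh1.continuous_deriv le_rfl
  obtain ⟨K, hK0, hK⟩ := exists_abs_cos_mul_le_sin_two_mul hh1 h0
  obtain ⟨H, hH'⟩ := isCompact_Icc.exists_bound_of_continuousOn (s := Icc 0 (π / 2)) hhc.continuousOn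
  obtain ⟨M, hM'⟩ := isCompact_Icc.exists_bound_of_continuousOn (s := Icc 0 (π / 2)) hdc.continuousOn
  obtain ⟨M₂, hM₂'⟩ := isCompact_Icc.exists_bound_of_continuousOn (s := Icc 0 (π / 2)) hd2c.continuousOn
  have hH0 : 0 ≤ H := (norm_nonneg _).trans (hH' 0 ⟨le_rfl, by positivity⟩)
  have hM0 : 0 ≤ M := (norm_nonneg _).trans (hM' 0 ⟨le_rfl, by positivity⟩)
  have hH : ∀ θ ∈ Ioo 0 (π / 2), |h θ| ≤ H := fun θ hθ => by
    have := hH' θ (Ioo_subset_Icc_self hθ); rwa [Real.norm_eq_abs] at this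
  have hM : ∀ θ ∈ Ioo 0 (π / 2), |deriv h θ| ≤ M := fun θ hθ => by
    have := hM' θ (Ioo_subset_Icc_self hθ); rwa [Real.norm_eq_abs] at this
  have hM₂ : ∀ θ ∈ Ioo 0 (π / 2), |deriv (deriv h) θ| ≤ M₂ := fun θ hθ => by
    have := hM₂' θ (Ioo_subset_Icc_self hθ); rwa [Real.norm_eq_abs] at this
  have hsin : ∀ θ ∈ Ioo 0 (π / 2), 0 < Real.sin (2 * θ) := fun θ hθ =>
    Real.sin_pos_of_pos_of_lt_pi (by linarith [hθ.1]) (by linarith [hθ.2])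
  have hs1 : ∀ θ : ℝ, |Real.sin (2 * θ)| ≤ 1 := fun θ => Real.abs_sin_le_one _
  have hcos1 : ∀ θ : ℝ, |Real.cos θ| ≤ 1 := fun θ => Real.abs_cos_le_one _
  -- atomic bounds: `|cos θ h| ≤ K`, `|cos θ h s⁻¹| ≤ K`
  have hchs : ∀ θ ∈ Ioo 0 (π / 2), |Real.cos θ * h θ * (Real.sin (2 * θ))⁻¹| ≤ K := fun θ hθ => by
    rw [abs_mul, abs_of_pos (inv_pos.2 (hsin θ hθ)), ← div_eq_mul_inv, div_le_iff₀ (hsin θ hθ)]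
    exact hK θ (Ioo_subset_Icc_self hθ)
  have hchK : ∀ θ ∈ Ioo 0 (π / 2), |Real.cos θ * h θ| ≤ K := fun θ hθ =>
    (hK θ (Ioo_subset_Icc_self hθ)).trans (by nlinarith [Real.sin_le_one (2 * θ)])
  obtain ⟨Φ', hΦ'⟩ : ∃ Φ' : ℝ → ℝ, Φ' = fun θ => -(Real.sin (2 * θ) * Real.sin (2 * θ) ^ (-η) * h θ * deriv h θ) -
      2 * η * (Real.cos (2 * θ) * Real.cos θ ^ 2 * Real.sin (2 * θ) ^ (-η) * (Real.sin (2 * θ))⁻¹ * h θ * deriv h θ) +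
      Real.cos θ ^ 2 * Real.sin (2 * θ) ^ (-η) * deriv h θ ^ 2 +
      Real.cos θ ^ 2 * Real.sin (2 * θ) ^ (-η) * h θ * deriv (deriv h) θ := ⟨_, rfl⟩
  have hderiv : ∀ θ ∈ Ioo 0 (π / 2),
      HasDerivAt (fun θ => Real.cos θ ^ 2 * Real.sin (2 * θ) ^ (-η) * h θ * deriv h θ) (Φ' θ) θ := by
    intro θ hθ
    have hs := hsin θ hθ
    have hsne : Real.sin (2 * θ) ≠ 0 := hs.ne'
    have hC2 : HasDerivAt (fun x => Real.cos x ^ 2) (-Real.sin (2 * θ)) θ := by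
      have e2 : (fun x => Real.cos x ^ 2) = fun x => Real.cos x * Real.cos x := by funext x; ring
      rw [e2]
      refine ((Real.hasDerivAt_cos θ).fun_mul (Real.hasDerivAt_cos θ)).congr_deriv ?_
      rw [Real.sin_two_mul]; ring
    have hU := hasDerivAt_sin_two_mul_rpow (-η) hθ
    have hall := ((hC2.fun_mul hU).fun_mul (hd θ).hasDerivAt).fun_mul (hdd θ).hasDerivAt
    refine hall.congr_deriv ?_
    simp only [hΦ']
    field_simp
    ring
  have hΦ'b : ∀ θ ∈ Ioo 0 (π / 2), |Φ' θ| ≤ (H * M + 2 * η * (K * M) + M * M + K * M₂) * Real.sin (2 * θ) ^ (-η) := by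
    intro θ hθ
    have hs := hsin θ hθ
    have hu : 0 ≤ Real.sin (2 * θ) ^ (-η) := Real.rpow_nonneg hs.le _
    have t1 : |-(Real.sin (2 * θ) * Real.sin (2 * θ) ^ (-η) * h θ * deriv h θ)| ≤ H * M * Real.sin (2 * θ) ^ (-η) := by
      have e : -(Real.sin (2 * θ) * Real.sin (2 * θ) ^ (-η) * h θ * deriv h θ) =
          -((Real.sin (2 * θ) * h θ * deriv h θ) * Real.sin (2 * θ) ^ (-η)) := by ring
      rw [e, abs_neg, abs_mul, abs_of_nonneg hu]
      have hb := abs_mul₃_le (hs1 θ) (hH θ hθ) (hM θ hθ) zero_le_one hH0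
      calc _ ≤ 1 * H * M * Real.sin (2 * θ) ^ (-η) := mul_le_mul_of_nonneg_right hb hu
        _ = _ := by ring
    have t2 : |2 * η * (Real.cos (2 * θ) * Real.cos θ ^ 2 * Real.sin (2 * θ) ^ (-η) * (Real.sin (2 * θ))⁻¹ * h θ *
        deriv h θ)| ≤ 2 * η * (K * M) * Real.sin (2 * θ) ^ (-η) := by
      have e : 2 * η * (Real.cos (2 * θ) * Real.cos θ ^ 2 * Real.sin (2 * θ) ^ (-η) * (Real.sin (2 * θ))⁻¹ * h θ *
          deriv h θ) = 2 * η * ((Real.cos (2 * θ) * Real.cos θ * (Real.cos θ * h θ * (Real.sin (2 * θ))⁻¹) * deriv h θ) *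
          Real.sin (2 * θ) ^ (-η)) := by ring
      have h2η : (0 : ℝ) ≤ 2 * η := by positivity
      rw [e, abs_mul, abs_of_nonneg h2η, abs_mul, abs_of_nonneg hu]
      have hb := abs_mul₄_le (Real.abs_cos_le_one (2 * θ)) (hcos1 θ) (hchs θ hθ) (hM θ hθ) zero_le_one zero_le_one hK0
      have := mul_le_mul_of_nonneg_right hb hu
      calc _ ≤ 2 * η * (1 * 1 * K * M * Real.sin (2 * θ) ^ (-η)) := mul_le_mul_of_nonneg_left this h2η
        _ = _ := by ring
    have t3 : |Real.cos θ ^ 2 * Real.sin (2 * θ) ^ (-η) * deriv h θ ^ 2| ≤ M * M * Real.sin (2 * θ) ^ (-η) := by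
      have e : Real.cos θ ^ 2 * Real.sin (2 * θ) ^ (-η) * deriv h θ ^ 2 =
          (Real.cos θ * Real.cos θ * deriv h θ * deriv h θ) * Real.sin (2 * θ) ^ (-η) := by ring
      rw [e, abs_mul, abs_of_nonneg hu]
      have hb := abs_mul₄_le (hcos1 θ) (hcos1 θ) (hM θ hθ) (hM θ hθ) zero_le_one zero_le_one hM0
      calc _ ≤ 1 * 1 * M * M * Real.sin (2 * θ) ^ (-η) := mul_le_mul_of_nonneg_right hb hu
        _ = _ := by ring
    have t4 : |Real.cos θ ^ 2 * Real.sin (2 * θ) ^ (-η) * h θ * deriv (deriv h) θ| ≤ K * M₂ * Real.sin (2 * θ) ^ (-η) := by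
      have e : Real.cos θ ^ 2 * Real.sin (2 * θ) ^ (-η) * h θ * deriv (deriv h) θ =
          (Real.cos θ * (Real.cos θ * h θ) * deriv (deriv h) θ) * Real.sin (2 * θ) ^ (-η) := by ring
      rw [e, abs_mul, abs_of_nonneg hu]
      have hb := abs_mul₃_le (hcos1 θ) (hchK θ hθ) (hM₂ θ hθ) zero_le_one hK0
      calc _ ≤ 1 * K * M₂ * Real.sin (2 * θ) ^ (-η) := mul_le_mul_of_nonneg_right hb hu
        _ = _ := by ring
    rw [hΦ']
    calc _ ≤ |-(Real.sin (2 * θ) * Real.sin (2 * θ) ^ (-η) * h θ * deriv h θ) -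
          2 * η * (Real.cos (2 * θ) * Real.cos θ ^ 2 * Real.sin (2 * θ) ^ (-η) * (Real.sin (2 * θ))⁻¹ * h θ * deriv h θ) +
          Real.cos θ ^ 2 * Real.sin (2 * θ) ^ (-η) * deriv h θ ^ 2| +
          |Real.cos θ ^ 2 * Real.sin (2 * θ) ^ (-η) * h θ * deriv (deriv h) θ| := abs_add_le _ _
      _ ≤ |-(Real.sin (2 * θ) * Real.sin (2 * θ) ^ (-η) * h θ * deriv h θ) -
          2 * η * (Real.cos (2 * θ) * Real.cos θ ^ 2 * Real.sin (2 * θ) ^ (-η) * (Real.sin (2 * θ))⁻¹ * h θ * deriv h θ)| +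
          |Real.cos θ ^ 2 * Real.sin (2 * θ) ^ (-η) * deriv h θ ^ 2| +
          |Real.cos θ ^ 2 * Real.sin (2 * θ) ^ (-η) * h θ * deriv (deriv h) θ| := by gcongr ?_ + _; exact abs_add_le _ _
      _ ≤ |-(Real.sin (2 * θ) * Real.sin (2 * θ) ^ (-η) * h θ * deriv h θ)| +
          |2 * η * (Real.cos (2 * θ) * Real.cos θ ^ 2 * Real.sin (2 * θ) ^ (-η) * (Real.sin (2 * θ))⁻¹ * h θ * deriv h θ)| +
          |Real.cos θ ^ 2 * Real.sin (2 * θ) ^ (-η) * deriv h θ ^ 2| +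
          |Real.cos θ ^ 2 * Real.sin (2 * θ) ^ (-η) * h θ * deriv (deriv h) θ| :=
          by gcongr ?_ + _ + _; exact abs_sub _ _
      _ ≤ _ := by linarith
  have hΦb : ∀ θ ∈ Ioo 0 (π / 2), |Real.cos θ ^ 2 * Real.sin (2 * θ) ^ (-η) * h θ * deriv h θ| ≤
      K * M * Real.sin (2 * θ) ^ (1 - η) := by
    intro θ hθ
    have hs := hsin θ hθ
    have hu : 0 ≤ Real.sin (2 * θ) ^ (-η) := Real.rpow_nonneg hs.le _
    have e : Real.sin (2 * θ) ^ (1 - η) = Real.sin (2 * θ) * Real.sin (2 * θ) ^ (-η) := by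
      rw [sub_eq_add_neg, Real.rpow_add hs, Real.rpow_one]
    have e2 : Real.cos θ ^ 2 * Real.sin (2 * θ) ^ (-η) * h θ * deriv h θ =
        (Real.cos θ * (Real.cos θ * h θ) * deriv h θ) * Real.sin (2 * θ) ^ (-η) := by ring
    rw [e, e2, abs_mul, abs_of_nonneg hu]
    have hb := abs_mul₃_le (hcos1 θ) (hK θ (Ioo_subset_Icc_self hθ)) (hM θ hθ) zero_le_one (by positivity)
    calc _ ≤ 1 * (K * Real.sin (2 * θ)) * M * Real.sin (2 * θ) ^ (-η) := mul_le_mul_of_nonneg_right hb hu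
      _ = _ := by ring
  have hum : Measurable fun θ : ℝ => Real.sin (2 * θ) ^ (-η) :=
    (by fun_prop : Measurable fun θ : ℝ => Real.sin (2 * θ)).pow_const _
  have hhm : Measurable h := hhc.measurable
  have hdm : Measurable (deriv h) := hdc.measurable
  have hd2m : Measurable (deriv (deriv h)) := hd2c.measurable
  have hmΦ' : Measurable Φ' := by rw [hΦ']; fun_prop
  have iΦ' : IntegrableOn Φ' (Ioo 0 (π / 2)) :=
    integrableOn_Ioo_of_abs_le_mul_rpow hη0 hη1 hmΦ'.aestronglyMeasurable hΦ'b
  have iA : IntegrableOn (fun θ => Real.sin (2 * θ) * Real.sin (2 * θ) ^ (-η) * h θ * deriv h θ) (Ioo 0 (π / 2)) := by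
    refine integrableOn_Ioo_of_abs_le_mul_rpow hη0 hη1 (C := H * M) ?_ ?_
    · exact (by fun_prop : Measurable fun θ => Real.sin (2 * θ) * Real.sin (2 * θ) ^ (-η) * h θ * deriv h θ).aestronglyMeasurable
    · intro θ hθ
      have hu : 0 ≤ Real.sin (2 * θ) ^ (-η) := Real.rpow_nonneg (hsin θ hθ).le _
      have e : Real.sin (2 * θ) * Real.sin (2 * θ) ^ (-η) * h θ * deriv h θ =
          (Real.sin (2 * θ) * h θ * deriv h θ) * Real.sin (2 * θ) ^ (-η) := by ring
      rw [e, abs_mul, abs_of_nonneg hu]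
      have hb := abs_mul₃_le (hs1 θ) (hH θ hθ) (hM θ hθ) zero_le_one hH0
      calc _ ≤ 1 * H * M * Real.sin (2 * θ) ^ (-η) := mul_le_mul_of_nonneg_right hb hu
        _ = _ := by ring
  have iB : IntegrableOn (fun θ => Real.cos (2 * θ) * Real.cos θ ^ 2 * Real.sin (2 * θ) ^ (-η) * (Real.sin (2 * θ))⁻¹ *
      h θ * deriv h θ) (Ioo 0 (π / 2)) := by
    refine integrableOn_Ioo_of_abs_le_mul_rpow hη0 hη1 (C := K * M) ?_ ?_
    · exact (by fun_prop : Measurable fun θ => Real.cos (2 * θ) * Real.cos θ ^ 2 * Real.sin (2 * θ) ^ (-η) *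
        (Real.sin (2 * θ))⁻¹ * h θ * deriv h θ).aestronglyMeasurable
    · intro θ hθ
      have hu : 0 ≤ Real.sin (2 * θ) ^ (-η) := Real.rpow_nonneg (hsin θ hθ).le _
      have e : Real.cos (2 * θ) * Real.cos θ ^ 2 * Real.sin (2 * θ) ^ (-η) * (Real.sin (2 * θ))⁻¹ * h θ * deriv h θ =
          (Real.cos (2 * θ) * Real.cos θ * (Real.cos θ * h θ * (Real.sin (2 * θ))⁻¹) * deriv h θ) *
            Real.sin (2 * θ) ^ (-η) := by ring
      rw [e, abs_mul, abs_of_nonneg hu]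
      have hb := abs_mul₄_le (Real.abs_cos_le_one (2 * θ)) (hcos1 θ) (hchs θ hθ) (hM θ hθ) zero_le_one zero_le_one hK0
      calc _ ≤ 1 * 1 * K * M * Real.sin (2 * θ) ^ (-η) := mul_le_mul_of_nonneg_right hb hu
        _ = _ := by ring
  have iC : IntegrableOn (fun θ => Real.cos θ ^ 2 * Real.sin (2 * θ) ^ (-η) * deriv h θ ^ 2) (Ioo 0 (π / 2)) := by
    refine integrableOn_Ioo_of_abs_le_mul_rpow hη0 hη1 (C := M * M) ?_ ?_
    · exact (by fun_prop : Measurable fun θ => Real.cos θ ^ 2 * Real.sin (2 * θ) ^ (-η) * deriv h θ ^ 2).aestronglyMeasurable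
    · intro θ hθ
      have hu : 0 ≤ Real.sin (2 * θ) ^ (-η) := Real.rpow_nonneg (hsin θ hθ).le _
      have e : Real.cos θ ^ 2 * Real.sin (2 * θ) ^ (-η) * deriv h θ ^ 2 =
          (Real.cos θ * Real.cos θ * deriv h θ * deriv h θ) * Real.sin (2 * θ) ^ (-η) := by ring
      rw [e, abs_mul, abs_of_nonneg hu]
      have hb := abs_mul₄_le (hcos1 θ) (hcos1 θ) (hM θ hθ) (hM θ hθ) zero_le_one zero_le_one hM0
      calc _ ≤ 1 * 1 * M * M * Real.sin (2 * θ) ^ (-η) := mul_le_mul_of_nonneg_right hb hu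
        _ = _ := by ring
  have iD : IntegrableOn (fun θ => Real.cos θ ^ 2 * Real.sin (2 * θ) ^ (-η) * h θ * deriv (deriv h) θ) (Ioo 0 (π / 2)) := by
    refine integrableOn_Ioo_of_abs_le_mul_rpow hη0 hη1 (C := K * M₂) ?_ ?_
    · exact (by fun_prop : Measurable fun θ => Real.cos θ ^ 2 * Real.sin (2 * θ) ^ (-η) * h θ *
        deriv (deriv h) θ).aestronglyMeasurable
    · intro θ hθ
      have hu : 0 ≤ Real.sin (2 * θ) ^ (-η) := Real.rpow_nonneg (hsin θ hθ).le _
      have e : Real.cos θ ^ 2 * Real.sin (2 * θ) ^ (-η) * h θ * deriv (deriv h) θ =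
          (Real.cos θ * (Real.cos θ * h θ) * deriv (deriv h) θ) * Real.sin (2 * θ) ^ (-η) := by ring
      rw [e, abs_mul, abs_of_nonneg hu]
      have hb := abs_mul₃_le (hcos1 θ) (hchK θ hθ) (hM₂ θ hθ) zero_le_one hK0
      calc _ ≤ 1 * K * M₂ * Real.sin (2 * θ) ^ (-η) := mul_le_mul_of_nonneg_right hb hu
        _ = _ := by ring
  have h0' := integral_Ioo_eq_zero_of_hasDerivAt_of_abs_le_rpow (by linarith : (0 : ℝ) < 1 - η) hderiv iΦ' hΦb
  have e : ∫ θ in Ioo 0 (π / 2), Φ' θ = -(∫ θ in Ioo 0 (π / 2), Real.sin (2 * θ) * Real.sin (2 * θ) ^ (-η) * h θ * deriv h θ) -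
      2 * η * (∫ θ in Ioo 0 (π / 2), Real.cos (2 * θ) * Real.cos θ ^ 2 * Real.sin (2 * θ) ^ (-η) * (Real.sin (2 * θ))⁻¹ *
        h θ * deriv h θ) +
      (∫ θ in Ioo 0 (π / 2), Real.cos θ ^ 2 * Real.sin (2 * θ) ^ (-η) * deriv h θ ^ 2) +
      ∫ θ in Ioo 0 (π / 2), Real.cos θ ^ 2 * Real.sin (2 * θ) ^ (-η) * h θ * deriv (deriv h) θ := by
    have i1 : IntegrableOn (fun θ => -(Real.sin (2 * θ) * Real.sin (2 * θ) ^ (-η) * h θ * deriv h θ)) (Ioo 0 (π / 2)) := iA.neg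
    have i2 : IntegrableOn (fun θ => 2 * η * (Real.cos (2 * θ) * Real.cos θ ^ 2 * Real.sin (2 * θ) ^ (-η) *
        (Real.sin (2 * θ))⁻¹ * h θ * deriv h θ)) (Ioo 0 (π / 2)) := iB.const_mul _
    have i12 : IntegrableOn (fun θ => -(Real.sin (2 * θ) * Real.sin (2 * θ) ^ (-η) * h θ * deriv h θ) -
        2 * η * (Real.cos (2 * θ) * Real.cos θ ^ 2 * Real.sin (2 * θ) ^ (-η) * (Real.sin (2 * θ))⁻¹ * h θ * deriv h θ))
        (Ioo 0 (π / 2)) := i1.sub i2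
    have i123 : IntegrableOn (fun θ => -(Real.sin (2 * θ) * Real.sin (2 * θ) ^ (-η) * h θ * deriv h θ) -
        2 * η * (Real.cos (2 * θ) * Real.cos θ ^ 2 * Real.sin (2 * θ) ^ (-η) * (Real.sin (2 * θ))⁻¹ * h θ * deriv h θ) +
        Real.cos θ ^ 2 * Real.sin (2 * θ) ^ (-η) * deriv h θ ^ 2) (Ioo 0 (π / 2)) := i12.add iC
    rw [hΦ', integral_add i123 iD, integral_add i12 iC, integral_sub i1 i2, MeasureTheory.integral_neg,
      MeasureTheory.integral_const_mul]
  rw [e] at h0'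
  linarith

/-- **L6**: `∫₀^{π/2} c cos²θ u s⁻¹ h h′ = ∫₀^{π/2} cos²θ u h² + ½∫₀^{π/2} c u h² +
(1+η)∫₀^{π/2} c² u (cos θ h/s)²` for `h ∈ C¹(ℝ)` with `h(0) = 0` (boundary function
`½ c cos²θ u h²/s = O(sin(2θ)^{1−η})`). [cite: Elgindi2021, §7.3 proof of Proposition 7.7 Step 2, treatment of `I₄` via `Ψ̄ = Ψ/cos θ` (p. 21–22 of arXiv:1904.04795)] -/
theorem integral_Ioo_cos_cos_sq_rpow_inv_mul_mul_deriv {h : ℝ → ℝ} (hh : ContDiff ℝ 1 h) (h0 : h 0 = 0) :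
    ∫ θ in Ioo 0 (π / 2), Real.cos (2 * θ) * Real.cos θ ^ 2 * Real.sin (2 * θ) ^ (-η) * (Real.sin (2 * θ))⁻¹ *
        h θ * deriv h θ =
      (∫ θ in Ioo 0 (π / 2), Real.cos θ ^ 2 * Real.sin (2 * θ) ^ (-η) * h θ ^ 2) +
        (1 / 2) * (∫ θ in Ioo 0 (π / 2), Real.cos (2 * θ) * Real.sin (2 * θ) ^ (-η) * h θ ^ 2) +
        (1 + η) * ∫ θ in Ioo 0 (π / 2), Real.cos (2 * θ) ^ 2 * Real.sin (2 * θ) ^ (-η) *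
          (Real.cos θ * h θ / Real.sin (2 * θ)) ^ 2 := by
  have hd : Differentiable ℝ h := hh.differentiable (by simp)
  have hhc : Continuous h := hh.continuous
  have hdc : Continuous (deriv h) := hh.continuous_deriv le_rfl
  obtain ⟨K, hK0, hK⟩ := exists_abs_cos_mul_le_sin_two_mul hh h0
  obtain ⟨H, hH'⟩ := isCompact_Icc.exists_bound_of_continuousOn (s := Icc 0 (π / 2)) hhc.continuousOn
  obtain ⟨M, hM'⟩ := isCompact_Icc.exists_bound_of_continuousOn (s := Icc 0 (π / 2)) hdc.continuousOn
  have hH0 : 0 ≤ H := (norm_nonneg _).trans (hH' 0 ⟨le_rfl, by positivity⟩)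
  have hH : ∀ θ ∈ Ioo 0 (π / 2), |h θ| ≤ H := fun θ hθ => by
    have := hH' θ (Ioo_subset_Icc_self hθ); rwa [Real.norm_eq_abs] at this
  have hM : ∀ θ ∈ Ioo 0 (π / 2), |deriv h θ| ≤ M := fun θ hθ => by
    have := hM' θ (Ioo_subset_Icc_self hθ); rwa [Real.norm_eq_abs] at this
  have hsin : ∀ θ ∈ Ioo 0 (π / 2), 0 < Real.sin (2 * θ) := fun θ hθ =>
    Real.sin_pos_of_pos_of_lt_pi (by linarith [hθ.1]) (by linarith [hθ.2])
  have hcos1 : ∀ θ : ℝ, |Real.cos θ| ≤ 1 := fun θ => Real.abs_cos_le_one _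
  have hchs : ∀ θ ∈ Ioo 0 (π / 2), |Real.cos θ * h θ * (Real.sin (2 * θ))⁻¹| ≤ K := fun θ hθ => by
    rw [abs_mul, abs_of_pos (inv_pos.2 (hsin θ hθ)), ← div_eq_mul_inv, div_le_iff₀ (hsin θ hθ)]
    exact hK θ (Ioo_subset_Icc_self hθ)
  have hchs' : ∀ θ ∈ Ioo 0 (π / 2), |Real.cos θ * h θ / Real.sin (2 * θ)| ≤ K := fun θ hθ => by
    rw [div_eq_mul_inv]; exact hchs θ hθ
  have hchK : ∀ θ ∈ Ioo 0 (π / 2), |Real.cos θ * h θ| ≤ K := fun θ hθ =>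
    (hK θ (Ioo_subset_Icc_self hθ)).trans (by nlinarith [Real.sin_le_one (2 * θ)])
  obtain ⟨Φ', hΦ'⟩ : ∃ Φ' : ℝ → ℝ, Φ' = fun θ => -(Real.cos θ ^ 2 * Real.sin (2 * θ) ^ (-η) * h θ ^ 2) -
      (1 / 2) * (Real.cos (2 * θ) * Real.sin (2 * θ) ^ (-η) * h θ ^ 2) -
      (1 + η) * (Real.cos (2 * θ) ^ 2 * Real.sin (2 * θ) ^ (-η) * (Real.cos θ * h θ / Real.sin (2 * θ)) ^ 2) +
      Real.cos (2 * θ) * Real.cos θ ^ 2 * Real.sin (2 * θ) ^ (-η) * (Real.sin (2 * θ))⁻¹ * h θ * deriv h θ := ⟨_, rfl⟩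
  have hderiv : ∀ θ ∈ Ioo 0 (π / 2), HasDerivAt (fun θ => (1 / 2) * Real.cos (2 * θ) * Real.cos θ ^ 2 *
      Real.sin (2 * θ) ^ (-η) * (Real.sin (2 * θ))⁻¹ * h θ ^ 2) (Φ' θ) θ := by
    intro θ hθ
    have hs := hsin θ hθ
    have hsne : Real.sin (2 * θ) ≠ 0 := hs.ne'
    have h2 : HasDerivAt (fun x : ℝ => 2 * x) 2 θ := by
      simpa using (hasDerivAt_id' θ).const_mul (2 : ℝ)
    have hS : HasDerivAt (fun x => Real.sin (2 * x)) (Real.cos (2 * θ) * 2) θ := h2.sin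
    have hC : HasDerivAt (fun x => Real.cos (2 * x)) (-Real.sin (2 * θ) * 2) θ := h2.cos
    have hC2 : HasDerivAt (fun x => Real.cos x ^ 2) (-Real.sin (2 * θ)) θ := by
      have e2 : (fun x => Real.cos x ^ 2) = fun x => Real.cos x * Real.cos x := by funext x; ring
      rw [e2]
      refine ((Real.hasDerivAt_cos θ).fun_mul (Real.hasDerivAt_cos θ)).congr_deriv ?_
      rw [Real.sin_two_mul]; ring
    have hU := hasDerivAt_sin_two_mul_rpow (-η) hθ
    have hI : HasDerivAt (fun x => (Real.sin (2 * x))⁻¹)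
        (-(Real.cos (2 * θ) * 2) / Real.sin (2 * θ) ^ 2) θ := hS.fun_inv hsne
    have e2 : (fun y => h y ^ 2) = fun y => h y * h y := by funext y; ring
    have hP : HasDerivAt (fun y => h y ^ 2) (deriv h θ * h θ + h θ * deriv h θ) θ := by
      rw [e2]; exact (hd θ).hasDerivAt.fun_mul (hd θ).hasDerivAt
    have hall := (((((hC.const_mul (1 / 2 : ℝ)).fun_mul hC2).fun_mul hU).fun_mul hI).fun_mul hP)
    refine hall.congr_deriv ?_
    simp only [hΦ']
    field_simp
    ring
  have hΦ'b : ∀ θ ∈ Ioo 0 (π / 2), |Φ' θ| ≤ (K * K + (1 / 2) * (H * H) + (1 + η) * (K * K) + K * M) * Real.sin (2 * θ) ^ (-η) := by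
    intro θ hθ
    have hs := hsin θ hθ
    have hu : 0 ≤ Real.sin (2 * θ) ^ (-η) := Real.rpow_nonneg hs.le _
    have hc1 := Real.abs_cos_le_one (2 * θ)
    have t1 : |-(Real.cos θ ^ 2 * Real.sin (2 * θ) ^ (-η) * h θ ^ 2)| ≤ K * K * Real.sin (2 * θ) ^ (-η) := by
      have e : -(Real.cos θ ^ 2 * Real.sin (2 * θ) ^ (-η) * h θ ^ 2) =
          -(((Real.cos θ * h θ) * (Real.cos θ * h θ)) * Real.sin (2 * θ) ^ (-η)) := by ring
      rw [e, abs_neg, abs_mul, abs_of_nonneg hu]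
      exact mul_le_mul_of_nonneg_right (abs_mul₂_le (hchK θ hθ) (hchK θ hθ) hK0) hu
    have t2 : |(1 / 2) * (Real.cos (2 * θ) * Real.sin (2 * θ) ^ (-η) * h θ ^ 2)| ≤ (1 / 2) * (H * H) * Real.sin (2 * θ) ^ (-η) := by
      have e : (1 / 2) * (Real.cos (2 * θ) * Real.sin (2 * θ) ^ (-η) * h θ ^ 2) =
          (1 / 2) * ((Real.cos (2 * θ) * h θ * h θ) * Real.sin (2 * θ) ^ (-η)) := by ring
      rw [e, abs_mul, abs_of_nonneg (by norm_num : (0 : ℝ) ≤ 1 / 2), abs_mul, abs_of_nonneg hu]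
      have hb := abs_mul₃_le hc1 (hH θ hθ) (hH θ hθ) zero_le_one hH0
      have := mul_le_mul_of_nonneg_right hb hu
      calc _ ≤ (1 / 2) * (1 * H * H * Real.sin (2 * θ) ^ (-η)) := mul_le_mul_of_nonneg_left this (by norm_num)
        _ = _ := by ring
    have t3 : |(1 + η) * (Real.cos (2 * θ) ^ 2 * Real.sin (2 * θ) ^ (-η) * (Real.cos θ * h θ / Real.sin (2 * θ)) ^ 2)| ≤
        (1 + η) * (K * K) * Real.sin (2 * θ) ^ (-η) := by
      have e : (1 + η) * (Real.cos (2 * θ) ^ 2 * Real.sin (2 * θ) ^ (-η) * (Real.cos θ * h θ / Real.sin (2 * θ)) ^ 2) =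
          (1 + η) * ((Real.cos (2 * θ) * Real.cos (2 * θ) * (Real.cos θ * h θ / Real.sin (2 * θ)) *
            (Real.cos θ * h θ / Real.sin (2 * θ))) * Real.sin (2 * θ) ^ (-η)) := by ring
      have h1η : (0 : ℝ) ≤ 1 + η := by linarith
      rw [e, abs_mul, abs_of_nonneg h1η, abs_mul, abs_of_nonneg hu]
      have hb := abs_mul₄_le hc1 hc1 (hchs' θ hθ) (hchs' θ hθ) zero_le_one zero_le_one hK0
      have := mul_le_mul_of_nonneg_right hb hu
      calc _ ≤ (1 + η) * (1 * 1 * K * K * Real.sin (2 * θ) ^ (-η)) := mul_le_mul_of_nonneg_left this h1η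
        _ = _ := by ring
    have t4 : |Real.cos (2 * θ) * Real.cos θ ^ 2 * Real.sin (2 * θ) ^ (-η) * (Real.sin (2 * θ))⁻¹ * h θ * deriv h θ| ≤
        K * M * Real.sin (2 * θ) ^ (-η) := by
      have e : Real.cos (2 * θ) * Real.cos θ ^ 2 * Real.sin (2 * θ) ^ (-η) * (Real.sin (2 * θ))⁻¹ * h θ * deriv h θ =
          (Real.cos (2 * θ) * Real.cos θ * (Real.cos θ * h θ * (Real.sin (2 * θ))⁻¹) * deriv h θ) *
            Real.sin (2 * θ) ^ (-η) := by ring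
      rw [e, abs_mul, abs_of_nonneg hu]
      have hb := abs_mul₄_le hc1 (hcos1 θ) (hchs θ hθ) (hM θ hθ) zero_le_one zero_le_one hK0
      calc _ ≤ 1 * 1 * K * M * Real.sin (2 * θ) ^ (-η) := mul_le_mul_of_nonneg_right hb hu
        _ = _ := by ring
    rw [hΦ']
    calc _ ≤ |-(Real.cos θ ^ 2 * Real.sin (2 * θ) ^ (-η) * h θ ^ 2) -
          (1 / 2) * (Real.cos (2 * θ) * Real.sin (2 * θ) ^ (-η) * h θ ^ 2) -
          (1 + η) * (Real.cos (2 * θ) ^ 2 * Real.sin (2 * θ) ^ (-η) * (Real.cos θ * h θ / Real.sin (2 * θ)) ^ 2)| +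
          |Real.cos (2 * θ) * Real.cos θ ^ 2 * Real.sin (2 * θ) ^ (-η) * (Real.sin (2 * θ))⁻¹ * h θ * deriv h θ| :=
          abs_add_le _ _
      _ ≤ |-(Real.cos θ ^ 2 * Real.sin (2 * θ) ^ (-η) * h θ ^ 2) -
          (1 / 2) * (Real.cos (2 * θ) * Real.sin (2 * θ) ^ (-η) * h θ ^ 2)| +
          |(1 + η) * (Real.cos (2 * θ) ^ 2 * Real.sin (2 * θ) ^ (-η) * (Real.cos θ * h θ / Real.sin (2 * θ)) ^ 2)| +
          |Real.cos (2 * θ) * Real.cos θ ^ 2 * Real.sin (2 * θ) ^ (-η) * (Real.sin (2 * θ))⁻¹ * h θ * deriv h θ| :=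
          by gcongr ?_ + _; exact abs_sub _ _
      _ ≤ |-(Real.cos θ ^ 2 * Real.sin (2 * θ) ^ (-η) * h θ ^ 2)| +
          |(1 / 2) * (Real.cos (2 * θ) * Real.sin (2 * θ) ^ (-η) * h θ ^ 2)| +
          |(1 + η) * (Real.cos (2 * θ) ^ 2 * Real.sin (2 * θ) ^ (-η) * (Real.cos θ * h θ / Real.sin (2 * θ)) ^ 2)| +
          |Real.cos (2 * θ) * Real.cos θ ^ 2 * Real.sin (2 * θ) ^ (-η) * (Real.sin (2 * θ))⁻¹ * h θ * deriv h θ| :=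
          by gcongr ?_ + _ + _; exact abs_sub _ _
      _ ≤ _ := by linarith
  have hΦb : ∀ θ ∈ Ioo 0 (π / 2), |(1 / 2) * Real.cos (2 * θ) * Real.cos θ ^ 2 *
      Real.sin (2 * θ) ^ (-η) * (Real.sin (2 * θ))⁻¹ * h θ ^ 2| ≤ (1 / 2) * (K * K) * Real.sin (2 * θ) ^ (1 - η) := by
    intro θ hθ
    have hs := hsin θ hθ
    have hu : 0 ≤ Real.sin (2 * θ) ^ (-η) := Real.rpow_nonneg hs.le _
    have e : Real.sin (2 * θ) ^ (1 - η) = Real.sin (2 * θ) * Real.sin (2 * θ) ^ (-η) := by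
      rw [sub_eq_add_neg, Real.rpow_add hs, Real.rpow_one]
    have e2 : (1 / 2) * Real.cos (2 * θ) * Real.cos θ ^ 2 * Real.sin (2 * θ) ^ (-η) * (Real.sin (2 * θ))⁻¹ * h θ ^ 2 =
        (1 / 2) * ((Real.cos (2 * θ) * (Real.cos θ * h θ * (Real.sin (2 * θ))⁻¹) * (Real.cos θ * h θ)) *
          Real.sin (2 * θ) ^ (-η)) := by ring
    rw [e, e2, abs_mul, abs_of_nonneg (by norm_num : (0 : ℝ) ≤ 1 / 2), abs_mul, abs_of_nonneg hu]
    have hb := abs_mul₃_le (Real.abs_cos_le_one (2 * θ)) (hchs θ hθ) (hK θ (Ioo_subset_Icc_self hθ)) zero_le_one hK0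
    have := mul_le_mul_of_nonneg_right hb hu
    calc _ ≤ (1 / 2) * (1 * K * (K * Real.sin (2 * θ)) * Real.sin (2 * θ) ^ (-η)) :=
          mul_le_mul_of_nonneg_left this (by norm_num)
      _ = _ := by ring
  have hum : Measurable fun θ : ℝ => Real.sin (2 * θ) ^ (-η) :=
    (by fun_prop : Measurable fun θ : ℝ => Real.sin (2 * θ)).pow_const _
  have hhm : Measurable h := hhc.measurable
  have hdm : Measurable (deriv h) := hdc.measurable
  have hmΦ' : Measurable Φ' := by rw [hΦ']; fun_prop
  have iΦ' : IntegrableOn Φ' (Ioo 0 (π / 2)) :=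
    integrableOn_Ioo_of_abs_le_mul_rpow hη0 hη1 hmΦ'.aestronglyMeasurable hΦ'b
  have iA : IntegrableOn (fun θ => Real.cos θ ^ 2 * Real.sin (2 * θ) ^ (-η) * h θ ^ 2) (Ioo 0 (π / 2)) := by
    refine integrableOn_Ioo_of_abs_le_mul_rpow hη0 hη1 (C := K * K) ?_ ?_
    · exact (by fun_prop : Measurable fun θ => Real.cos θ ^ 2 * Real.sin (2 * θ) ^ (-η) * h θ ^ 2).aestronglyMeasurable
    · intro θ hθ
      have hu : 0 ≤ Real.sin (2 * θ) ^ (-η) := Real.rpow_nonneg (hsin θ hθ).le _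
      have e : Real.cos θ ^ 2 * Real.sin (2 * θ) ^ (-η) * h θ ^ 2 =
          ((Real.cos θ * h θ) * (Real.cos θ * h θ)) * Real.sin (2 * θ) ^ (-η) := by ring
      rw [e, abs_mul, abs_of_nonneg hu]
      exact mul_le_mul_of_nonneg_right (abs_mul₂_le (hchK θ hθ) (hchK θ hθ) hK0) hu
  have iB : IntegrableOn (fun θ => Real.cos (2 * θ) * Real.sin (2 * θ) ^ (-η) * h θ ^ 2) (Ioo 0 (π / 2)) := by
    refine integrableOn_Ioo_of_abs_le_mul_rpow hη0 hη1 (C := H * H) ?_ ?_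
    · exact (by fun_prop : Measurable fun θ => Real.cos (2 * θ) * Real.sin (2 * θ) ^ (-η) * h θ ^ 2).aestronglyMeasurable
    · intro θ hθ
      have hu : 0 ≤ Real.sin (2 * θ) ^ (-η) := Real.rpow_nonneg (hsin θ hθ).le _
      have e : Real.cos (2 * θ) * Real.sin (2 * θ) ^ (-η) * h θ ^ 2 = (Real.cos (2 * θ) * h θ * h θ) * Real.sin (2 * θ) ^ (-η) := by
        ring
      rw [e, abs_mul, abs_of_nonneg hu]
      have hb := abs_mul₃_le (Real.abs_cos_le_one (2 * θ)) (hH θ hθ) (hH θ hθ) zero_le_one hH0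
      calc _ ≤ 1 * H * H * Real.sin (2 * θ) ^ (-η) := mul_le_mul_of_nonneg_right hb hu
        _ = _ := by ring
  have iC : IntegrableOn (fun θ => Real.cos (2 * θ) ^ 2 * Real.sin (2 * θ) ^ (-η) *
      (Real.cos θ * h θ / Real.sin (2 * θ)) ^ 2) (Ioo 0 (π / 2)) := by
    refine integrableOn_Ioo_of_abs_le_mul_rpow hη0 hη1 (C := K * K) ?_ ?_
    · exact (by fun_prop : Measurable fun θ => Real.cos (2 * θ) ^ 2 * Real.sin (2 * θ) ^ (-η) *
        (Real.cos θ * h θ / Real.sin (2 * θ)) ^ 2).aestronglyMeasurable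
    · intro θ hθ
      have hu : 0 ≤ Real.sin (2 * θ) ^ (-η) := Real.rpow_nonneg (hsin θ hθ).le _
      have e : Real.cos (2 * θ) ^ 2 * Real.sin (2 * θ) ^ (-η) * (Real.cos θ * h θ / Real.sin (2 * θ)) ^ 2 =
          (Real.cos (2 * θ) * Real.cos (2 * θ) * (Real.cos θ * h θ / Real.sin (2 * θ)) *
            (Real.cos θ * h θ / Real.sin (2 * θ))) * Real.sin (2 * θ) ^ (-η) := by ring
      rw [e, abs_mul, abs_of_nonneg hu]
      have hb := abs_mul₄_le (Real.abs_cos_le_one (2 * θ)) (Real.abs_cos_le_one (2 * θ)) (hchs' θ hθ) (hchs' θ hθ)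
        zero_le_one zero_le_one hK0
      calc _ ≤ 1 * 1 * K * K * Real.sin (2 * θ) ^ (-η) := mul_le_mul_of_nonneg_right hb hu
        _ = _ := by ring
  have iD : IntegrableOn (fun θ => Real.cos (2 * θ) * Real.cos θ ^ 2 * Real.sin (2 * θ) ^ (-η) * (Real.sin (2 * θ))⁻¹ *
      h θ * deriv h θ) (Ioo 0 (π / 2)) := by
    refine integrableOn_Ioo_of_abs_le_mul_rpow hη0 hη1 (C := K * M) ?_ ?_
    · exact (by fun_prop : Measurable fun θ => Real.cos (2 * θ) * Real.cos θ ^ 2 * Real.sin (2 * θ) ^ (-η) *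
        (Real.sin (2 * θ))⁻¹ * h θ * deriv h θ).aestronglyMeasurable
    · intro θ hθ
      have hu : 0 ≤ Real.sin (2 * θ) ^ (-η) := Real.rpow_nonneg (hsin θ hθ).le _
      have e : Real.cos (2 * θ) * Real.cos θ ^ 2 * Real.sin (2 * θ) ^ (-η) * (Real.sin (2 * θ))⁻¹ * h θ * deriv h θ =
          (Real.cos (2 * θ) * Real.cos θ * (Real.cos θ * h θ * (Real.sin (2 * θ))⁻¹) * deriv h θ) *
            Real.sin (2 * θ) ^ (-η) := by ring
      rw [e, abs_mul, abs_of_nonneg hu]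
      have hb := abs_mul₄_le (Real.abs_cos_le_one (2 * θ)) (hcos1 θ) (hchs θ hθ) (hM θ hθ) zero_le_one zero_le_one hK0
      calc _ ≤ 1 * 1 * K * M * Real.sin (2 * θ) ^ (-η) := mul_le_mul_of_nonneg_right hb hu
        _ = _ := by ring
  have h0' := integral_Ioo_eq_zero_of_hasDerivAt_of_abs_le_rpow (by linarith : (0 : ℝ) < 1 - η) hderiv iΦ' hΦb
  have e : ∫ θ in Ioo 0 (π / 2), Φ' θ = -(∫ θ in Ioo 0 (π / 2), Real.cos θ ^ 2 * Real.sin (2 * θ) ^ (-η) * h θ ^ 2) -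
      (1 / 2) * (∫ θ in Ioo 0 (π / 2), Real.cos (2 * θ) * Real.sin (2 * θ) ^ (-η) * h θ ^ 2) -
      (1 + η) * (∫ θ in Ioo 0 (π / 2), Real.cos (2 * θ) ^ 2 * Real.sin (2 * θ) ^ (-η) *
        (Real.cos θ * h θ / Real.sin (2 * θ)) ^ 2) +
      ∫ θ in Ioo 0 (π / 2), Real.cos (2 * θ) * Real.cos θ ^ 2 * Real.sin (2 * θ) ^ (-η) * (Real.sin (2 * θ))⁻¹ *
        h θ * deriv h θ := by
    have i1 : IntegrableOn (fun θ => -(Real.cos θ ^ 2 * Real.sin (2 * θ) ^ (-η) * h θ ^ 2)) (Ioo 0 (π / 2)) := iA.neg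
    have i2 : IntegrableOn (fun θ => (1 / 2) * (Real.cos (2 * θ) * Real.sin (2 * θ) ^ (-η) * h θ ^ 2)) (Ioo 0 (π / 2)) :=
      iB.const_mul _
    have i3 : IntegrableOn (fun θ => (1 + η) * (Real.cos (2 * θ) ^ 2 * Real.sin (2 * θ) ^ (-η) *
        (Real.cos θ * h θ / Real.sin (2 * θ)) ^ 2)) (Ioo 0 (π / 2)) := iC.const_mul _
    have i12 : IntegrableOn (fun θ => -(Real.cos θ ^ 2 * Real.sin (2 * θ) ^ (-η) * h θ ^ 2) -
        (1 / 2) * (Real.cos (2 * θ) * Real.sin (2 * θ) ^ (-η) * h θ ^ 2)) (Ioo 0 (π / 2)) := i1.sub i2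
    have i123 : IntegrableOn (fun θ => -(Real.cos θ ^ 2 * Real.sin (2 * θ) ^ (-η) * h θ ^ 2) -
        (1 / 2) * (Real.cos (2 * θ) * Real.sin (2 * θ) ^ (-η) * h θ ^ 2) -
        (1 + η) * (Real.cos (2 * θ) ^ 2 * Real.sin (2 * θ) ^ (-η) * (Real.cos θ * h θ / Real.sin (2 * θ)) ^ 2))
        (Ioo 0 (π / 2)) := i12.sub i3
    rw [hΦ', integral_add i123 iD, integral_sub i12 i3, integral_sub i1 i2, MeasureTheory.integral_neg,
      MeasureTheory.integral_const_mul, MeasureTheory.integral_const_mul]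
  rw [e] at h0'
  linarith

end theta

end Elgindi

end Literature.Analysis.FluidPDE
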